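import Literature.NumberTheory.Transcendental.KZCubeJoint
import HarnessLib

/-!
# The cube calculus of end-regularised iterated integrals, IV: the kite and the corner product
identity

**The log-free corner principle, formal version.**  For the four direction data of a corner
chart (`KiteData`: `y`-words at transverse position `X`, `x`-words at transverse position `Y`,
and their degenerations at transverse coordinate `0`), flat and axis-central at every rider
scale with the cross identifications of transverse coefficients and head multipliers at the
scale point (`KiteData.Hyp`), the KITE functional

  `𝒲_j[ρ](π) = β̄ 𝐙^y_j + ᾱ 𝐙^{0x}_j − ᾱ 𝐙^x_j − β̄ 𝐙^{0y}_j + ᾱβ̄ Σ_{i+i'=j} (JZ^{y,0x}_{i,i'} − JZ^{x,0y}_{i,i'})[ρπ]`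

vanishes identically in every positive degree (`KiteData.kite`), by induction on the degree:
the (S)-steps of parts I–III, the expansions (O)/TF-Z in the active slots, the abstract ring
identity `kite_abs`, axis commutation for the junk, and the degree-one closed-loop identity
`kite_abs_one` (hypothesis `Hyp.B1`, `∮ dlog φ = 0` around the scaled rectangle).  At the base
stage (no riders, multiplier `1`, scale `1`) the joints factor for a multiplicative realisation
(`JZ_base_eq_mul`, Fubini), and summing over degrees gives the **corner product identity**
(`KiteData.corner_product`)

  `(1 + β̄ ΣQ^y)(1 + ᾱ ΣQ^{0x}) = (1 + ᾱ ΣQ^x)(1 + β̄ ΣQ^{0y})`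

in any algebra where the four series vanish above degree `N` — the identity
`V_α(β)·H_0(α) = H_β(α)·V_0(β)` between the log-free (end-regularised) horizontal and vertical
transports of a flat bilinear corner chart, which yields the five corner identities of the KZ
associator's atlas [Furusho2010, §3], [Drinfeld1990, §2].

References: H. Furusho, *Pentagon and hexagon equations*, Ann. of Math. 171 (2010), §3;
V. Drinfeld, Leningrad Math. J. 2 (1991), §2; [cite: IharaKanekoZagier2006, §3];
[cite: KontsevichZagier2001, §1.2].
-/

noncomputable section

open MeasureTheory Set MvPolynomial
open Literature.ModelTheory.ExponentialFields (IsSemialgebraic analyticOnNhd_aeval continuous_aeval_real)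
open Literature.NumberTheory.Transcendental

namespace Literature.NumberTheory.Transcendental.KZ.Cube

variable {M N : ℕ}

/-! ## The KITE: abstract algebra of the induction step and of the base -/

section KiteAlgebra

open Finset

variable {R : Type} [CommRing R] {A : Type} [Ring A] [Algebra R A]
variable {ι : Type} [Fintype ι]

/-- **The abstract KITE step identity**: expansion = target + junk. [folklore] -/
theorem kite_abs (ab bb : R) (t : ι → A) (tX tY : A)
    -- singles, degree p, base multiplier
    (Y1 X01 X1 Y01 : A) (Yc X0c Xc Y0c Ycx Yc0x Xcy Xc0y X0cx X0cy Y0cx Y0cy : ι → A)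
    -- joint-boundary singles (multiplier ρ⁺π⁺·…)
    (X0pi Ypi Y0pi Xpi : A) (X0ly X0eby Yl0x Y0lx Y0ebx Xl0y : ι → A)
    -- joints (degree p, multiplier ρ⁺π⁺·…)
    (P N PmidY PmidX NmidX NmidY : A) (Pc Pcx Pmc0x Nc Ncy Nmc0y : ι → A)
    -- scalar identities (solved form)
    (hsX0 : ∀ ℓ, X0cx ℓ = bb • (X0ly ℓ + X0eby ℓ) + X0c ℓ - X0cy ℓ)
    (hsY0 : ∀ ℓ, Y0cx ℓ = ab • (Y0lx ℓ + Y0ebx ℓ) + Y0c ℓ - Y0cy ℓ)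
    (hsX : ∀ ℓ, Xc0y ℓ = bb • Xl0y ℓ)
    (hsY : ∀ ℓ, Yc0x ℓ = ab • Yl0x ℓ) :
    -- LHS: the expansion of 𝒲_{p+1}
    bb • (((tY * Y1 + ∑ ℓ, t ℓ * Yc ℓ) - Y1 * tY)
          + (tX * Y1 - Y1 * tX + ∑ ℓ, (t ℓ * Ycx ℓ - Yc0x ℓ * t ℓ))) +
    ab • ((tX * X01 + ∑ ℓ, t ℓ * X0c ℓ) - X01 * tX) -
    ab • (((tX * X1 + ∑ ℓ, t ℓ * Xc ℓ) - X1 * tX)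
          + (tY * X1 - X1 * tY + ∑ ℓ, (t ℓ * Xcy ℓ - Xc0y ℓ * t ℓ))) -
    bb • ((tY * Y01 + ∑ ℓ, t ℓ * Y0c ℓ) - Y01 * tY) +
    (ab * bb) • (
      ((((tY * X0pi + ∑ ℓ, t ℓ * X0ly ℓ) - tY * X0pi) + ((tY * P + ∑ ℓ, t ℓ * Pc ℓ) - PmidY))
        + ((∑ ℓ, t ℓ * X0eby ℓ) + (tX * P - PmidX + ∑ ℓ, (t ℓ * Pcx ℓ - Pmc0x ℓ)))
        + (((Ypi * tX + ∑ ℓ, Yl0x ℓ * t ℓ) - Ypi * tX) + ((PmidX + ∑ ℓ, Pmc0x ℓ) - P * tX)))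
      - ((((tX * Y0pi + ∑ ℓ, t ℓ * Y0lx ℓ) - tX * Y0pi) + ((tX * N + ∑ ℓ, t ℓ * Nc ℓ) - NmidX))
        + ((∑ ℓ, t ℓ * Y0ebx ℓ) + (tY * N - NmidY + ∑ ℓ, (t ℓ * Ncy ℓ - Nmc0y ℓ)))
        + (((Xpi * tY + ∑ ℓ, Xl0y ℓ * t ℓ) - Xpi * tY) + ((NmidY + ∑ ℓ, Nmc0y ℓ) - N * tY)))) =
    -- RHS: target + junk
    (tX * (bb • Y1 + ab • X01 - ab • X1 - bb • Y01 + (ab * bb) • (P - N)) -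
      (bb • Y1 + ab • X01 - ab • X1 - bb • Y01 + (ab * bb) • (P - N)) * tX) +
    (tY * (bb • Y1 + ab • X01 - ab • X1 - bb • Y01 + (ab * bb) • (P - N)) -
      (bb • Y1 + ab • X01 - ab • X1 - bb • Y01 + (ab * bb) • (P - N)) * tY) +
    ∑ ℓ, t ℓ * ((bb • Ycx ℓ + ab • X0cx ℓ - ab • Xc ℓ - bb • Y0cx ℓ + (ab * bb) • (Pcx ℓ - Nc ℓ)) +
               (bb • Yc ℓ + ab • X0cy ℓ - ab • Xcy ℓ - bb • Y0cy ℓ + (ab * bb) • (Pc ℓ - Ncy ℓ))) +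
    (bb • (tX * Y01 - Y01 * tX) - ab • (tY * X01 - X01 * tY) + (ab * bb) • (P * tY - PmidY) + (ab * bb) • (NmidX - N * tX)) := by
  simp only [hsX0, hsY0, hsX, hsY, smul_add, smul_sub, mul_add, mul_sub, add_mul, sub_mul,
    Finset.sum_add_distrib, Finset.sum_sub_distrib, smul_mul_assoc, mul_smul_comm, smul_smul, ← Finset.smul_sum]
  module

/-- **The abstract KITE base identity** (degree 1). [folklore] -/
theorem kite_abs_one (ab bb : R) (t : ι → A) (tX tY : A) (r1 : R) (ly lx l0y l0x eby ebx : ι → R)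
    (h : ∀ ℓ, bb * (ly ℓ + eby ℓ - l0y ℓ) = ab * (lx ℓ + ebx ℓ - l0x ℓ)) :
    bb • ((tY * (r1 • (1 : A)) + ∑ ℓ, t ℓ * (ly ℓ • (1 : A))) - (r1 • (1 : A)) * tY + ∑ ℓ, eby ℓ • t ℓ) +
    ab • ((tX * (r1 • (1 : A)) + ∑ ℓ, t ℓ * (l0x ℓ • (1 : A))) - (r1 • (1 : A)) * tX) -
    ab • ((tX * (r1 • (1 : A)) + ∑ ℓ, t ℓ * (lx ℓ • (1 : A))) - (r1 • (1 : A)) * tX + ∑ ℓ, ebx ℓ • t ℓ) -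
    bb • ((tY * (r1 • (1 : A)) + ∑ ℓ, t ℓ * (l0y ℓ • (1 : A))) - (r1 • (1 : A)) * tY) = 0 := by
  have key : ∀ ℓ, bb • (ly ℓ • t ℓ) + bb • (eby ℓ • t ℓ) - bb • (l0y ℓ • t ℓ)
      - (ab • (lx ℓ • t ℓ) + ab • (ebx ℓ • t ℓ) - ab • (l0x ℓ • t ℓ)) = 0 := by
    intro ℓ
    simp only [smul_smul, ← add_smul, ← sub_smul]
    rw [show bb * ly ℓ + bb * eby ℓ - bb * l0y ℓ - (ab * lx ℓ + ab * ebx ℓ - ab * l0x ℓ) = 0 from by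
      linear_combination h ℓ, zero_smul]
  simp only [mul_smul_comm, smul_mul_assoc, mul_one, one_mul, smul_add, smul_sub, Finset.smul_sum]
  have hsum : ∑ ℓ, (bb • (ly ℓ • t ℓ) + bb • (eby ℓ • t ℓ) - bb • (l0y ℓ • t ℓ)
      - (ab • (lx ℓ • t ℓ) + ab • (ebx ℓ • t ℓ) - ab • (l0x ℓ • t ℓ))) = 0 := Finset.sum_eq_zero fun ℓ _ => key ℓ
  simp only [Finset.sum_sub_distrib, Finset.sum_add_distrib] at hsum
  refine Eq.trans ?_ hsum
  abel


end KiteAlgebra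

/-! ## Linearity of the series in the multiplier; joint congruence -/

section MultLin

open Shuffle NCSeries

variable {R : Type} [CommRing R] [Algebra ℚ R] {χ : KZ.FormalRep →+ R} (hrel : ∀ c ∈ KZ.relations, χ c = 0)
variable {ι : Type} [Fintype ι] [DecidableEq ι] {m k M : ℕ}
variable {A : Type} [Ring A] [Algebra R A] [Module ℚ A] [IsScalarTower ℚ R A]
variable (c : ℚ) (hc : 0 ≤ c) (d : ι → Letter m) (hd : ∀ a, (d a).IsRegular c)

include hrel

omit [Module ℚ A] [IsScalarTower ℚ R A] in
/-- `ZS` is additive in the multiplier. [folklore] -/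
theorem ZS_add_mult (ρ₁ ρ₂ : RFun (m + k)) (j : ℕ) (t : ι → A) (o : ι) (π : MvPolynomial (Fin (m + k)) ℚ) (hπ : IsScale π) :
    ZS (χ := χ) c hc d hd j t o (ρ₁.add ρ₂) π hπ = ZS (χ := χ) c hc d hd j t o ρ₁ π hπ + ZS (χ := χ) c hc d hd j t o ρ₂ π hπ := by
  unfold ZS
  rw [← evalW_add]
  congr 1; funext W
  simp only [Zser, NCSeries.add_apply]
  split_ifs
  · simp
  · rw [← pair_add_fun']
    refine pair_congr fun v _ => ?_
    rw [zcoef, zcoef, zcoef, ← RFun.chi_add hrel]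
    exact RFun.chi_congr hrel fun y hy => by rw [fn_famTerm, RFun.fn_add hy, RFun.fn_add (fun i => hy _), fn_famTerm, fn_famTerm]; ring

omit [Module ℚ A] [IsScalarTower ℚ R A] in
/-- `ZS` is `ℚ`-homogeneous in the multiplier. [folklore] -/
theorem ZS_const_mul_mult (q : ℚ) (ρ : RFun (m + k)) (j : ℕ) (t : ι → A) (o : ι) (π : MvPolynomial (Fin (m + k)) ℚ) (hπ : IsScale π) :
    ZS (χ := χ) c hc d hd j t o ((RFun.const q).mul ρ) π hπ = algebraMap ℚ R q • ZS (χ := χ) c hc d hd j t o ρ π hπ := by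
  unfold ZS
  rw [← evalW_smul']
  congr 1; funext W
  simp only [Zser, NCSeries.smul_apply]
  split_ifs
  · simp
  · have hz : ∀ v, zcoef (χ := χ) c hc d hd ((RFun.const q).mul ρ) π hπ v = algebraMap ℚ R q * zcoef (χ := χ) c hc d hd ρ π hπ v := by
      intro v
      rw [zcoef, zcoef, ← RFun.chi_const_mul hrel]
      exact RFun.chi_congr hrel fun y _ => by
        rw [fn_famTerm, RFun.fn_mul, RFun.fn_const, RFun.fn_mul, RFun.fn_const, fn_famTerm]; ring
    simp only [pair, Finsupp.sum, hz, smul_eq_mul, Finset.mul_sum, mul_smul_comm]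

omit [Module ℚ A] [IsScalarTower ℚ R A] in
/-- A pointwise sum of multipliers gives the sum of the series. [folklore] -/
theorem ZS_add_mult' {ρ₁ ρ₂ ρ₃ : RFun (m + k)} (h : ∀ e ∈ KZ.cube (m + k), ρ₁.fn e + ρ₂.fn e = ρ₃.fn e)
    (j : ℕ) (t : ι → A) (o : ι) (π : MvPolynomial (Fin (m + k)) ℚ) (hπ : IsScale π) :
    ZS (χ := χ) c hc d hd j t o ρ₁ π hπ + ZS (χ := χ) c hc d hd j t o ρ₂ π hπ = ZS (χ := χ) c hc d hd j t o ρ₃ π hπ := by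
  rw [← ZS_add_mult hrel]
  exact ZS_congr_mult hrel c hc d hd (fun e he => by rw [RFun.fn_add he, h e he]) j t o π hπ

omit [Module ℚ A] [IsScalarTower ℚ R A] in
/-- A pointwise difference of multipliers gives the difference of the series. [folklore] -/
theorem ZS_sub_mult' {ρ₁ ρ₂ ρ₃ : RFun (m + k)} (h : ∀ e ∈ KZ.cube (m + k), ρ₁.fn e - ρ₂.fn e = ρ₃.fn e)
    (j : ℕ) (t : ι → A) (o : ι) (π : MvPolynomial (Fin (m + k)) ℚ) (hπ : IsScale π) :
    ZS (χ := χ) c hc d hd j t o ρ₁ π hπ - ZS (χ := χ) c hc d hd j t o ρ₂ π hπ = ZS (χ := χ) c hc d hd j t o ρ₃ π hπ := by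
  rw [sub_eq_iff_eq_add]
  exact (ZS_add_mult' hrel c hc d hd (fun e he => by rw [← h e he]; ring) j t o π hπ).symm

omit [Module ℚ A] [IsScalarTower ℚ R A] in
/-- A pointwise rational multiple of a multiplier gives the multiple of the series. [folklore] -/
theorem ZS_const_mul_mult' (q : ℚ) {ρ₁ ρ₂ : RFun (m + k)} (h : ∀ e ∈ KZ.cube (m + k), (q : ℝ) * ρ₁.fn e = ρ₂.fn e)
    (j : ℕ) (t : ι → A) (o : ι) (π : MvPolynomial (Fin (m + k)) ℚ) (hπ : IsScale π) :
    algebraMap ℚ R q • ZS (χ := χ) c hc d hd j t o ρ₁ π hπ = ZS (χ := χ) c hc d hd j t o ρ₂ π hπ := by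
  rw [← ZS_const_mul_mult hrel]
  exact ZS_congr_mult hrel c hc d hd (fun e he => by rw [RFun.fn_mul, RFun.fn_const, h e he]) j t o π hπ

omit [Module ℚ A] [IsScalarTower ℚ R A] in
/-- `JZ` only depends on the values of the multiplier on the cube. [folklore] -/
theorem JZ_congr_mult [Module ℚ A] (D₁ D₂ : DirData ι M) (i i' : ℕ) (t₁ t₂ : Option ι → A) (mid : A) {ρ₁ ρ₂ : RFun M}
    (h : ∀ e ∈ KZ.cube M, ρ₁.fn e = ρ₂.fn e) (π : MvPolynomial (Fin M) ℚ) (hπ : IsScale (m := M) (k := 0) π) :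
    JZ (χ := χ) D₁ D₂ i i' t₁ t₂ mid ρ₁ π hπ = JZ (χ := χ) D₁ D₂ i i' t₁ t₂ mid ρ₂ π hπ := by
  unfold JZ
  refine Jsum_congr fun v => congrArg (· * mid) (ZS_congr_mult hrel (m := M) (k := v.length) _ _ _ _ (fun w hw => ?_) _ _ _ _ _)
  rw [fn_absorbR, fn_absorbR, h _ fun i => hw _]

omit [Module ℚ A] [IsScalarTower ℚ R A] in
/-- `JZ'` only depends on the values of the multiplier on the cube. [folklore] -/
theorem JZ'_congr_mult [Module ℚ A] (D₁ D₂ : DirData ι M) (i i' : ℕ) (t₁ t₂ : Option ι → A) (mid : A) {ρ₁ ρ₂ : RFun M}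
    (h : ∀ e ∈ KZ.cube M, ρ₁.fn e = ρ₂.fn e) (π : MvPolynomial (Fin M) ℚ) (hπ : IsScale (m := M) (k := 0) π) :
    JZ' (χ := χ) D₁ D₂ i i' t₁ t₂ mid ρ₁ π hπ = JZ' (χ := χ) D₁ D₂ i i' t₁ t₂ mid ρ₂ π hπ := by
  unfold JZ'
  refine Jsum'_congr fun u => congrArg (mid * ·) (ZS_congr_mult hrel (m := M) (k := u.length) _ _ _ _ (fun w hw => ?_) _ _ _ _ _)
  rw [fn_absorbR, fn_absorbR, h _ fun i => hw _]

end MultLin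


/-! ## The KITE: the scale point of a multiplier -/

section KiteSpt

variable {ι : Type} {M : ℕ}

/-- The scale point read by a multiplier over `M` riders. [folklore] -/
def spt {M : ℕ} (π : MvPolynomial (Fin M) ℚ) (e : Fin (M + 0) → ℝ) : Fin (M + 1) → ℝ :=
  Fin.snoc (fun j : Fin M => e (Fin.castAdd 0 j)) (aeval e π)

/-- The scale point lies in the cube. [folklore] -/
theorem spt_mem {M : ℕ} {π : MvPolynomial (Fin M) ℚ} (hπ : IsScale (m := M) (k := 0) π) {e : Fin (M + 0) → ℝ}
    (he : e ∈ KZ.cube (M + 0)) : spt π e ∈ KZ.cube (M + 1) :=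
  KZ.snoc_mem_cube_iff.2 ⟨fun _ => he _, (hπ e he).1, (hπ e he).2⟩

/-- Value of a multiplier times a scale-reading factor. [folklore] -/
theorem fn_mul_scaleFam0 {M : ℕ} (μ : RFun M) (g : RFun (M + 1)) (π : MvPolynomial (Fin M) ℚ) (hπ : IsScale (m := M) (k := 0) π)
    (e : Fin (M + 0) → ℝ) : (μ.mul (scaleFam (m := M) (k := 0) g π hπ)).fn e = μ.fn e * g.fn (spt π e) := by
  rw [RFun.fn_mul, fn_scaleFam]; rfl

/-- The `u`-coordinate of substituted data at the scale point. [folklore] -/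
theorem ur_spt {M : ℕ} (D : DirData ι M) (π : MvPolynomial (Fin M) ℚ) (e : Fin (M + 0) → ℝ) :
    D.ur (spt π e) = D.c * aeval e π := by
  simp [DirData.ur, spt]


end KiteSpt

/-! ## The KITE: the unknown functional and the hypotheses -/

section KiteDefs

open Shuffle NCSeries

variable {R : Type} [CommRing R] [Algebra ℚ R] {χ : KZ.FormalRep →+ R} (hrel : ∀ c ∈ KZ.relations, χ c = 0)
variable {ι : Type} [Fintype ι] [DecidableEq ι] {m : ℕ}
variable {A : Type} [Ring A] [Algebra R A] [Module ℚ A] [IsScalarTower ℚ R A]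

/-- Residues of a direction: divisor residues `t`, axis residue `t0`. [folklore] -/
def resid (t : ι → A) (t0 : A) : Option ι → A := fun a => a.elim t0 t

omit [Fintype ι] [DecidableEq ι] [Ring A] [Module ℚ A] in
/-- The axis residue. [folklore] -/
@[simp] theorem resid_none (t : ι → A) (t0 : A) : resid t t0 none = t0 := rfl

omit [Fintype ι] [DecidableEq ι] [Ring A] [Module ℚ A] in
/-- A divisor residue. [folklore] -/
@[simp] theorem resid_some (t : ι → A) (t0 : A) (ℓ : ι) : resid t t0 (some ℓ) = t ℓ := rfl

/-- The joint sum over interior bidegrees `(i, p - i)`, `1 ≤ i < p`. [folklore] -/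
def Psum (p : ℕ) (F : ℕ → ℕ → A) : A := ∑ i ∈ Finset.Ico 1 p, F i (p - i)

omit [Algebra R A] [Module ℚ A] [IsScalarTower ℚ R A] in
/-- No interior bidegrees in degree `≤ 1`. [folklore] -/
theorem Psum_le_one {p : ℕ} (hp : p ≤ 1) (F : ℕ → ℕ → A) : Psum p F = 0 := by
  rw [Psum, Finset.Ico_eq_empty (by omega), Finset.sum_empty]

omit [Algebra R A] [Module ℚ A] [IsScalarTower ℚ R A] in
/-- `Psum` is additive. [folklore] -/
theorem Psum_add (p : ℕ) (F G : ℕ → ℕ → A) : Psum p (fun i i' => F i i' + G i i') = Psum p F + Psum p G := by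
  simp [Psum, Finset.sum_add_distrib]

omit [Algebra R A] [Module ℚ A] [IsScalarTower ℚ R A] in
/-- `Psum` is subtractive. [folklore] -/
theorem Psum_sub (p : ℕ) (F G : ℕ → ℕ → A) : Psum p (fun i i' => F i i' - G i i') = Psum p F - Psum p G := by
  simp [Psum, Finset.sum_sub_distrib]

omit [Algebra R A] [Module ℚ A] [IsScalarTower ℚ R A] in
/-- A left constant passes through `Psum`. [folklore] -/
theorem Psum_mul_left (p : ℕ) (a : A) (F : ℕ → ℕ → A) : Psum p (fun i i' => a * F i i') = a * Psum p F := by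
  simp [Psum, Finset.mul_sum]

omit [Algebra R A] [Module ℚ A] [IsScalarTower ℚ R A] in
/-- A right constant passes through `Psum`. [folklore] -/
theorem Psum_mul_right (p : ℕ) (a : A) (F : ℕ → ℕ → A) : Psum p (fun i i' => F i i' * a) = Psum p F * a := by
  simp [Psum, Finset.sum_mul]

omit [DecidableEq ι] [Algebra R A] [Module ℚ A] [IsScalarTower ℚ R A] in
/-- `Psum` commutes with finite sums. [folklore] -/
theorem Psum_finset_sum (p : ℕ) (G : ι → ℕ → ℕ → A) : Psum p (fun i i' => ∑ ℓ, G ℓ i i') = ∑ ℓ, Psum p (G ℓ) := by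
  unfold Psum; rw [Finset.sum_comm]

omit [Algebra R A] [Module ℚ A] [IsScalarTower ℚ R A] in
/-- `Psum` of zero. [folklore] -/
theorem Psum_zero (p : ℕ) : Psum p (fun _ _ => (0 : A)) = 0 := by simp [Psum]

omit [Algebra R A] [Module ℚ A] [IsScalarTower ℚ R A] in
/-- `Psum` only depends on the interior values. [folklore] -/
theorem Psum_congr {p : ℕ} {F G : ℕ → ℕ → A} (h : ∀ i i', 0 < i → 0 < i' → i + i' = p → F i i' = G i i') : Psum p F = Psum p G := by
  refine Finset.sum_congr rfl fun i hi => ?_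
  rw [Finset.mem_Ico] at hi
  exact h i (p - i) (by omega) (by omega) (by omega)

omit [Algebra R A] [Module ℚ A] [IsScalarTower ℚ R A] in
/-- **Reindexing after a reduction in the first slot**: `Σ_{i+i'=p+1} F(i,i') = F(1,p) + Σ_{i₀+i'=p} F(i₀+1,i')`
(`p ≥ 1`). [folklore] -/
theorem Psum_succ_left {p : ℕ} (hp : 0 < p) (F : ℕ → ℕ → A) :
    Psum (p + 1) F = F 1 p + Psum p (fun i i' => F (i + 1) i') := by
  unfold Psum
  rw [Finset.sum_Ico_eq_sum_range, Finset.sum_Ico_eq_sum_range, show p + 1 - 1 = (p - 1) + 1 by omega,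
    Finset.sum_range_succ']
  rw [add_comm]
  congr 1
  refine Finset.sum_congr rfl fun i hi => ?_
  rw [Finset.mem_range] at hi
  congr 1; omega

omit [Algebra R A] [Module ℚ A] [IsScalarTower ℚ R A] in
/-- **Reindexing after a reduction in the second slot**: `Σ_{i+i'=p+1} F(i,i') = F(p,1) + Σ_{i+i₀'=p} F(i,i₀'+1)`
(`p ≥ 1`). [folklore] -/
theorem Psum_succ_right {p : ℕ} (hp : 0 < p) (F : ℕ → ℕ → A) :
    Psum (p + 1) F = F p 1 + Psum p (fun i i' => F i (i' + 1)) := by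
  unfold Psum
  rw [Finset.sum_Ico_succ_top (by omega : 1 ≤ p), add_comm]
  congr 1
  · congr 1; omega
  · refine Finset.sum_congr rfl fun i hi => ?_
    rw [Finset.mem_Ico] at hi
    congr 1; omega

/-- **The four direction data of a corner chart** read with a common transverse rider: the `y`-words
(`Dy`, transverse rider = `x`-scale), the `x`-words (`Dx`), and their degenerations at transverse
coordinate `0` (`D0y`, `D0x`). [folklore] -/
structure KiteData (ι : Type) (m : ℕ) where
  /-- `y`-direction data at transverse position `X`. -/
  Dy : DirData ι (m + 1)
  /-- `x`-direction data at transverse position `Y`. -/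
  Dx : DirData ι (m + 1)
  /-- `y`-direction data at `x = 0`. -/
  D0y : DirData ι (m + 1)
  /-- `x`-direction data at `y = 0`. -/
  D0x : DirData ι (m + 1)

namespace KiteData

variable (K : KiteData ι m)

/-- **The KITE functional** `𝒲_j[ρ](π) = β̄ ZS^y + ᾱ ZS^{0x} − ᾱ ZS^x − β̄ ZS^{0y} + ᾱβ̄ Σ_{i+i'=j} (JZ^{y,0x} − JZ^{x,0y})[ρπ]`
at rider scale `π` (all four data substituted at the common transverse rider `π`). [folklore] -/
def W (ab bb : ℚ) (t : ι → A) (tX tY : A) (j : ℕ) {k : ℕ} (ρ : RFun (m + k)) (π : MvPolynomial (Fin (m + k)) ℚ)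
    (hπ : IsScale π) : A :=
  algebraMap ℚ R bb • ZS (χ := χ) (m := m + k) (k := 0) (K.Dy.substY π hπ).c (K.Dy.substY π hπ).hc (K.Dy.substY π hπ).d
      (K.Dy.substY π hπ).hd j (resid t tY) none ρ π hπ +
  algebraMap ℚ R ab • ZS (χ := χ) (m := m + k) (k := 0) (K.D0x.substY π hπ).c (K.D0x.substY π hπ).hc (K.D0x.substY π hπ).d
      (K.D0x.substY π hπ).hd j (resid t tX) none ρ π hπ -
  algebraMap ℚ R ab • ZS (χ := χ) (m := m + k) (k := 0) (K.Dx.substY π hπ).c (K.Dx.substY π hπ).hc (K.Dx.substY π hπ).d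
      (K.Dx.substY π hπ).hd j (resid t tX) none ρ π hπ -
  algebraMap ℚ R bb • ZS (χ := χ) (m := m + k) (k := 0) (K.D0y.substY π hπ).c (K.D0y.substY π hπ).hc (K.D0y.substY π hπ).d
      (K.D0y.substY π hπ).hd j (resid t tY) none ρ π hπ +
  (algebraMap ℚ R ab * algebraMap ℚ R bb) • Psum j (fun i i' =>
      JZ (χ := χ) (M := m + k) (K.Dy.substY π hπ) (K.D0x.substY π hπ) i i' (resid t tY) (resid t tX) 1 (ρ.mul (RFun.poly π)) π hπ -
      JZ (χ := χ) (M := m + k) (K.Dx.substY π hπ) (K.D0y.substY π hπ) i i' (resid t tX) (resid t tY) 1 (ρ.mul (RFun.poly π)) π hπ)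

variable (R)

/-- **The KITE hypotheses**: scales, derivative data, flatness and axis commutation of the substituted
data at every rider scale, and the four cross identifications of transverse coefficients with head
multipliers. [folklore] -/
structure Hyp (ab bb : ℚ) (t : ι → A) (tX tY : A) : Prop where
  hab : 0 < ab
  hbb : 0 < bb
  cy : K.Dy.c = bb
  cx : K.Dx.c = ab
  c0y : K.D0y.c = bb
  c0x : K.D0x.c = ab
  dy : K.Dy.IsDeriv
  dx : K.Dx.IsDeriv
  d0y : K.D0y.IsDeriv
  d0x : K.D0x.IsDeriv
  f0y : K.D0y.DerivFree
  f0x : K.D0x.DerivFree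
  flatY : ∀ (k : ℕ) (π : MvPolynomial (Fin (m + k)) ℚ) (hπ : IsScale π), (K.Dy.substY π hπ).Flat R (resid t tY) tX
  flatX : ∀ (k : ℕ) (π : MvPolynomial (Fin (m + k)) ℚ) (hπ : IsScale π), (K.Dx.substY π hπ).Flat R (resid t tX) tY
  ax0y : ∀ (k : ℕ) (π : MvPolynomial (Fin (m + k)) ℚ) (hπ : IsScale π), (K.D0y.substY π hπ).AxisComm R (resid t tY) tX
  ax0x : ∀ (k : ℕ) (π : MvPolynomial (Fin (m + k)) ℚ) (hπ : IsScale π), (K.D0x.substY π hπ).AxisComm R (resid t tX) tY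
  Iy : ∀ (k : ℕ) (π : MvPolynomial (Fin (m + k)) ℚ) (hπ : IsScale π) (ℓ : ι) (e : Fin ((m + k) + 0) → ℝ),
    e ∈ KZ.cube ((m + k) + 0) → ((K.Dy.substY π hπ).eS ℓ).fn (spt π e) =
      (headS (K.Dx.substY π hπ).c (K.Dx.substY π hπ).hc ((K.Dx.substY π hπ).d (some ℓ)) ((K.Dx.substY π hπ).hd (some ℓ))).fn (spt π e)
  Ix : ∀ (k : ℕ) (π : MvPolynomial (Fin (m + k)) ℚ) (hπ : IsScale π) (ℓ : ι) (e : Fin ((m + k) + 0) → ℝ),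
    e ∈ KZ.cube ((m + k) + 0) → ((K.Dx.substY π hπ).eS ℓ).fn (spt π e) =
      (headS (K.Dy.substY π hπ).c (K.Dy.substY π hπ).hc ((K.Dy.substY π hπ).d (some ℓ)) ((K.Dy.substY π hπ).hd (some ℓ))).fn (spt π e)
  Iy0 : ∀ (k : ℕ) (π : MvPolynomial (Fin (m + k)) ℚ) (hπ : IsScale π) (ℓ : ι) (e : Fin ((m + k) + 0) → ℝ),
    e ∈ KZ.cube ((m + k) + 0) → ((K.Dy.substY π hπ).e0S ℓ).fn (spt π e) =
      (headS (K.D0x.substY π hπ).c (K.D0x.substY π hπ).hc ((K.D0x.substY π hπ).d (some ℓ)) ((K.D0x.substY π hπ).hd (some ℓ))).fn (spt π e)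
  Ix0 : ∀ (k : ℕ) (π : MvPolynomial (Fin (m + k)) ℚ) (hπ : IsScale π) (ℓ : ι) (e : Fin ((m + k) + 0) → ℝ),
    e ∈ KZ.cube ((m + k) + 0) → ((K.Dx.substY π hπ).e0S ℓ).fn (spt π e) =
      (headS (K.D0y.substY π hπ).c (K.D0y.substY π hπ).hc ((K.D0y.substY π hπ).d (some ℓ)) ((K.D0y.substY π hπ).hd (some ℓ))).fn (spt π e)
  /-- The degree-one (closed-loop) identity at the scale point. -/
  B1 : ∀ (k : ℕ) (π : MvPolynomial (Fin (m + k)) ℚ) (hπ : IsScale π) (ℓ : ι) (e : Fin ((m + k) + 0) → ℝ),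
    e ∈ KZ.cube ((m + k) + 0) →
      (bb : ℝ) * ((lastS (K.Dy.substY π hπ).c (K.Dy.substY π hπ).hc ((K.Dy.substY π hπ).d (some ℓ)) ((K.Dy.substY π hπ).hd (some ℓ))).fn (spt π e) +
          ((K.Dy.substY π hπ).ebrS ℓ).fn (spt π e) -
          (lastS (K.D0y.substY π hπ).c (K.D0y.substY π hπ).hc ((K.D0y.substY π hπ).d (some ℓ)) ((K.D0y.substY π hπ).hd (some ℓ))).fn (spt π e)) =
      (ab : ℝ) * ((lastS (K.Dx.substY π hπ).c (K.Dx.substY π hπ).hc ((K.Dx.substY π hπ).d (some ℓ)) ((K.Dx.substY π hπ).hd (some ℓ))).fn (spt π e) +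
          ((K.Dx.substY π hπ).ebrS ℓ).fn (spt π e) -
          (lastS (K.D0x.substY π hπ).c (K.D0x.substY π hπ).hc ((K.D0x.substY π hπ).d (some ℓ)) ((K.D0x.substY π hπ).hd (some ℓ))).fn (spt π e))

end KiteData

end KiteDefs


/-! ## Joint functionals with a middle insertion: slot change -/

section JointMid

open Shuffle NCSeries

variable {R : Type} [CommRing R] [Algebra ℚ R] {χ : KZ.FormalRep →+ R} (hrel : ∀ c ∈ KZ.relations, χ c = 0)
variable {ι : Type} [Fintype ι] [DecidableEq ι] {M : ℕ}
variable {A : Type} [Ring A] [Algebra R A] [Module ℚ A] [IsScalarTower ℚ R A]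

/-- The honest double functional with a middle insertion. [folklore] -/
def HHm (i i' : ℕ) (t₁ t₂ : Option ι → A) (mid : A) (c : List (Option ι) → List (Option ι) → R) : A :=
  ∑ f : Fin i → Option ι, ∑ g : Fin i' → Option ι,
    pair (fun u => pair (fun v => c u v • (tprod t₁ f * mid * tprod t₂ g)) (regEnd none (List.ofFn g))) (regEnd none (List.ofFn f))

/-- `HHm` in the slot-1-active form. [folklore] -/
theorem HHm_eq_Jsum {i : ℕ} (hi : 0 < i) (i' : ℕ) (t₁ t₂ : Option ι → A) (mid : A) (c : List (Option ι) → List (Option ι) → R) :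
    HHm i i' t₁ t₂ mid c = Jsum i' t₂ fun v => evalW i t₁ (serL c v) * mid := by
  have hne : ∀ f : Fin i → Option ι, List.ofFn f ≠ [] := by
    intro f h; have := congrArg List.length h; simp at this; omega
  unfold HHm Jsum evalW
  rw [Finset.sum_comm]
  refine Finset.sum_congr rfl fun g _ => ?_
  simp only [serL, if_neg (hne _), Finset.sum_mul, pair_finset_sum_fun, tprod]
  refine Finset.sum_congr rfl fun f _ => ?_
  simp only [pair, Finsupp.sum, Finset.sum_smul, Finset.smul_sum, Finset.sum_mul, smul_mul_assoc]
  rw [Finset.sum_comm]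
  refine Finset.sum_congr rfl fun v _ => Finset.sum_congr rfl fun u _ => ?_
  rw [smul_assoc ((regEnd none (List.ofFn f)) u) (c u v), smul_smul, mul_comm, mul_smul, mul_assoc]

/-- `HHm` in the slot-2-active form. [folklore] -/
theorem HHm_eq_Jsum' (i : ℕ) {i' : ℕ} (hi' : 0 < i') (t₁ t₂ : Option ι → A) (mid : A) (c : List (Option ι) → List (Option ι) → R) :
    HHm i i' t₁ t₂ mid c = Jsum' i t₁ fun u => mid * evalW i' t₂ (serR c u) := by
  have hne : ∀ g : Fin i' → Option ι, List.ofFn g ≠ [] := by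
    intro g h; have := congrArg List.length h; simp at this; omega
  unfold HHm Jsum' evalW
  refine Finset.sum_congr rfl fun f _ => ?_
  simp only [serR, if_neg (hne _), tprod, Finset.mul_sum]
  rw [pair_finset_sum_fun]
  refine Finset.sum_congr rfl fun g _ => ?_
  simp only [pair, Finsupp.sum, Finset.sum_smul, Finset.mul_sum, mul_smul_comm, smul_assoc, ← mul_assoc]

include hrel

/-- `JZ` with a middle insertion is `HHm`. [folklore] -/
theorem JZ_eq_HHm (D₁ D₂ : DirData ι M) {i : ℕ} (hi : 0 < i) (i' : ℕ) (t₁ t₂ : Option ι → A) (mid : A) (ρ : RFun M)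
    (π : MvPolynomial (Fin M) ℚ) (hπ : IsScale (m := M) (k := 0) π) :
    JZ (χ := χ) D₁ D₂ i i' t₁ t₂ mid ρ π hπ = HHm i i' t₁ t₂ mid (cbox (χ := χ) D₁ D₂ ρ π hπ) := by
  rw [HHm_eq_Jsum hi, JZ]
  refine Jsum_congr fun v => congrArg (· * mid) ?_
  rw [ZS]
  congr 1
  funext W
  simp only [Zser, serL]
  split_ifs
  · rfl
  · exact pair_congr fun u _ => (chi_famTerm_boxT_absorb hrel ρ _ _ π hπ).symm

/-- `JZ'` with a middle insertion is `HHm`. [folklore] -/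
theorem JZ'_eq_HHm (D₁ D₂ : DirData ι M) (i : ℕ) {i' : ℕ} (hi' : 0 < i') (t₁ t₂ : Option ι → A) (mid : A) (ρ : RFun M)
    (π : MvPolynomial (Fin M) ℚ) (hπ : IsScale (m := M) (k := 0) π) :
    JZ' (χ := χ) D₁ D₂ i i' t₁ t₂ mid ρ π hπ = HHm i i' t₁ t₂ mid (cbox (χ := χ) D₁ D₂ ρ π hπ) := by
  rw [HHm_eq_Jsum' i hi', JZ']
  refine Jsum'_congr fun u => congrArg (mid * ·) ?_
  rw [ZS]
  congr 1
  funext W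
  simp only [Zser, serR]
  split_ifs
  · rfl
  · exact pair_congr fun v _ => by
      rw [zcoef, ← chi_famTerm_boxT_absorb hrel ρ _ _ π hπ, cbox, chi_famTerm_boxT_swap hrel]

/-- **Slot change with a middle insertion**: `JZ^{mid} = JZ'^{mid}` (both degrees positive). [folklore] -/
theorem JZ_eq_JZ' (D₁ D₂ : DirData ι M) {i i' : ℕ} (hi : 0 < i) (hi' : 0 < i') (t₁ t₂ : Option ι → A) (mid : A) (ρ : RFun M)
    (π : MvPolynomial (Fin M) ℚ) (hπ : IsScale (m := M) (k := 0) π) :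
    JZ (χ := χ) D₁ D₂ i i' t₁ t₂ mid ρ π hπ = JZ' (χ := χ) D₁ D₂ i i' t₁ t₂ mid ρ π hπ := by
  rw [JZ_eq_HHm hrel _ _ hi, JZ'_eq_HHm hrel _ _ i hi']

end JointMid


/-! ## The KITE: pointwise identities at the scale point -/

section KitePointwise

variable {ι : Type} {M : ℕ}

namespace DirData

variable (D : DirData ι M)

/-- `u · last_ℓ = c_ℓ` pointwise. [folklore] -/
theorem ur_mul_fn_lastS (ℓ : ι) (w : Fin (M + 1) → ℝ) :
    D.ur w * (lastS D.c D.hc (D.d (some ℓ)) (D.hd (some ℓ))).fn w = (headS D.c D.hc (D.d (some ℓ)) (D.hd (some ℓ))).fn w := by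
  rw [fn_headS_some, fn_lastS_some]; ring

/-- `u · ĕ_ℓ = e_ℓ − e⁰_ℓ` pointwise on the cube. [folklore] -/
theorem ur_mul_fn_ebrS (ℓ : ι) {w : Fin (M + 1) → ℝ} (hw : w ∈ KZ.cube (M + 1)) :
    D.ur w * (D.ebrS ℓ).fn w = (D.eS ℓ).fn w - (D.e0S ℓ).fn w := by
  have h1 : D.Nr ℓ w * D.ur w + D.Mr ℓ w ≠ 0 := D.denr_ne ℓ hw
  have h2 := D.Mr_ne ℓ hw
  rw [fn_ebrS, fn_eS, fn_e0S, div_sub_div _ _ h1 h2, ← mul_div_assoc, div_eq_div_iff (mul_ne_zero h1 h2) (mul_ne_zero h1 h2)]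
  ring

end DirData

end KitePointwise

/-! ## The KITE: normalised expansions at residues `resid t t0` -/

section KiteExpand

open Shuffle NCSeries

variable {R : Type} [CommRing R] [Algebra ℚ R] {χ : KZ.FormalRep →+ R} (hrel : ∀ c ∈ KZ.relations, χ c = 0)
variable {ι : Type} [Fintype ι] [DecidableEq ι] {M : ℕ}
variable {A : Type} [Ring A] [Algebra R A] [Module ℚ A] [IsScalarTower ℚ R A]

namespace DirData

variable (D : DirData ι M)

omit [Fintype ι] [DecidableEq ι] in
/-- The head multiplier of the axis letter is `1` pointwise. [folklore] -/
theorem fn_mul_headMult_none (μ : RFun M) (π : MvPolynomial (Fin M) ℚ) (hπ : IsScale (m := M) (k := 0) π) (e : Fin (M + 0) → ℝ) :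
    (μ.mul (headMult (m := M) (k := 0) D.c D.hc (D.d none) (D.hd none) π hπ)).fn e = μ.fn e := by
  rw [RFun.fn_mul, headMult, fn_scaleFam, D.fn_headS_none, mul_one]

omit [Fintype ι] [DecidableEq ι] in
/-- The last multiplier of the axis letter is `1` pointwise. [folklore] -/
theorem fn_mul_lastMult_none (μ : RFun M) (π : MvPolynomial (Fin M) ℚ) (hπ : IsScale (m := M) (k := 0) π) (e : Fin (M + 0) → ℝ) :
    (μ.mul (lastMult (m := M) (k := 0) D.c D.hc (D.d none) (D.hd none) π hπ)).fn e = μ.fn e := by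
  rw [RFun.fn_mul, lastMult, fn_scaleFam, D.fn_lastS_none, mul_one]

include hrel

omit [Module ℚ A] [IsScalarTower ℚ R A] in
/-- **(O) at residues, normalised** (`p ≥ 1`). [folklore] -/
theorem DS_succ_resid {p : ℕ} (hp : p ≠ 0) (t : ι → A) (t0 : A) (μ : RFun M) (π : MvPolynomial (Fin M) ℚ)
    (hπ : IsScale (m := M) (k := 0) π) :
    DS (χ := χ) (m := M) (k := 0) D.c D.hc D.d D.hd (p + 1) (resid t t0) none μ π hπ =
      (t0 * ZS (χ := χ) (m := M) (k := 0) D.c D.hc D.d D.hd p (resid t t0) none μ π hπ +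
        ∑ ℓ, t ℓ * ZS (χ := χ) (m := M) (k := 0) D.c D.hc D.d D.hd p (resid t t0) none
          (μ.mul (headMult (m := M) (k := 0) D.c D.hc (D.d (some ℓ)) (D.hd (some ℓ)) π hπ)) π hπ) -
      ZS (χ := χ) (m := M) (k := 0) D.c D.hc D.d D.hd p (resid t t0) none μ π hπ * t0 := by
  rw [DS_succ' hrel (m := M) (k := 0) D.c D.hc D.d D.hd none D.d_none p (resid t t0) μ π hπ]
  simp only [if_neg hp, Fintype.sum_option, resid_none, resid_some]
  rw [ZS_congr_mult hrel (m := M) (k := 0) D.c D.hc D.d D.hd (fun e _ => D.fn_mul_headMult_none μ π hπ e)]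

omit [Module ℚ A] [IsScalarTower ℚ R A] in
/-- **(O) at residues in degree `1`, normalised.** [folklore] -/
theorem DS_one_resid (t : ι → A) (t0 : A) (μ : RFun M) (π : MvPolynomial (Fin M) ℚ) (hπ : IsScale (m := M) (k := 0) π) :
    DS (χ := χ) (m := M) (k := 0) D.c D.hc D.d D.hd 1 (resid t t0) none μ π hπ =
      (t0 * (μ.chi χ • (1 : A)) +
        ∑ ℓ, t ℓ * ((μ.mul (lastMult (m := M) (k := 0) D.c D.hc (D.d (some ℓ)) (D.hd (some ℓ)) π hπ)).chi χ • (1 : A))) -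
      (μ.chi χ • (1 : A)) * t0 := by
  rw [DS_succ' hrel (m := M) (k := 0) D.c D.hc D.d D.hd none D.d_none 0 (resid t t0) μ π hπ]
  simp only [↓reduceIte, Fintype.sum_option, resid_none, resid_some]
  rw [RFun.chi_congr hrel (fun e _ => D.fn_mul_lastMult_none μ π hπ e)]

/-- **TF-Z at residues, normalised** (`p ≥ 1`). [folklore] -/
theorem YS_succ_resid (hc0 : 0 < D.c) {t : ι → A} {t0 tT : A} (hF : D.Flat R (resid t t0) tT) {p : ℕ} (hp : p ≠ 0)
    (μ : RFun M) (π : MvPolynomial (Fin M) ℚ) (hπ : IsScale (m := M) (k := 0) π) :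
    D.YS (χ := χ) (k := 0) (p + 1) (resid t t0) μ π hπ =
      tT * ZS (χ := χ) (m := M) (k := 0) D.c D.hc D.d D.hd p (resid t t0) none μ π hπ -
        ZS (χ := χ) (m := M) (k := 0) D.c D.hc D.d D.hd p (resid t t0) none μ π hπ * tT +
      ∑ ℓ, (t ℓ * ZS (χ := χ) (m := M) (k := 0) D.c D.hc D.d D.hd p (resid t t0) none (μ.mul (scaleFam (m := M) (k := 0) (D.eS ℓ) π hπ)) π hπ -
        ZS (χ := χ) (m := M) (k := 0) D.c D.hc D.d D.hd p (resid t t0) none (μ.mul (scaleFam (m := M) (k := 0) (D.e0S ℓ) π hπ)) π hπ * t ℓ) := by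
  rw [D.tfz hrel (resid t t0) tT hc0 hF p 0 μ π hπ]
  simp only [if_neg hp, add_zero, resid_some]

/-- **TF-Z at residues in degree `1`, normalised.** [folklore] -/
theorem YS_one_resid (hc0 : 0 < D.c) {t : ι → A} {t0 tT : A} (hF : D.Flat R (resid t t0) tT)
    (μ : RFun M) (π : MvPolynomial (Fin M) ℚ) (hπ : IsScale (m := M) (k := 0) π) :
    D.YS (χ := χ) (k := 0) 1 (resid t t0) μ π hπ =
      ∑ ℓ, (μ.mul (scaleFam (m := M) (k := 0) (D.ebrS ℓ) π hπ)).chi χ • t ℓ := by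
  rw [D.tfz hrel (resid t t0) tT hc0 hF 0 0 μ π hπ]
  simp only [↓reduceIte, ZS_zero, mul_zero, zero_mul, sub_self, Finset.sum_const_zero, zero_add, resid_some]

end DirData

include hrel

/-- **`JD` in the active slot, interior, normalised** (`i ≥ 1`). [folklore] -/
theorem JD_succ_resid (D₁ D₂ : DirData ι M) {i : ℕ} (hi : i ≠ 0) {i' : ℕ} (hi' : 0 < i') (t : ι → A) (t0 : A)
    (tr₂ : Option ι → A) (mid : A) (μ : RFun M) (π : MvPolynomial (Fin M) ℚ) (hπ : IsScale (m := M) (k := 0) π) :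
    JD (χ := χ) D₁ D₂ (i + 1) i' (resid t t0) tr₂ mid μ π hπ =
      (t0 * JZ (χ := χ) D₁ D₂ i i' (resid t t0) tr₂ mid μ π hπ +
        ∑ ℓ, t ℓ * JZ (χ := χ) D₁ D₂ i i' (resid t t0) tr₂ mid
          (μ.mul (headMult (m := M) (k := 0) D₁.c D₁.hc (D₁.d (some ℓ)) (D₁.hd (some ℓ)) π hπ)) π hπ) -
      JZ (χ := χ) D₁ D₂ i i' (resid t t0) tr₂ (t0 * mid) μ π hπ := by
  rw [JD_succ hrel D₁ D₂ i hi' (resid t t0) tr₂ mid μ π hπ]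
  simp only [if_neg hi, Fintype.sum_option, resid_none, resid_some]
  rw [JZ_congr_mult hrel D₁ D₂ i i' _ _ mid (fun e _ => D₁.fn_mul_headMult_none μ π hπ e)]

/-- **`JD` in the active slot, boundary `i = 1`, normalised.** [folklore] -/
theorem JD_one_resid (D₁ D₂ : DirData ι M) {i' : ℕ} (hi' : 0 < i') (t : ι → A) (t0 : A)
    (tr₂ : Option ι → A) (mid : A) (μ : RFun M) (π : MvPolynomial (Fin M) ℚ) (hπ : IsScale (m := M) (k := 0) π) :
    JD (χ := χ) D₁ D₂ 1 i' (resid t t0) tr₂ mid μ π hπ =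
      (t0 * (mid * ZS (χ := χ) (m := M) (k := 0) D₂.c D₂.hc D₂.d D₂.hd i' tr₂ none μ π hπ) +
        ∑ ℓ, t ℓ * (mid * ZS (χ := χ) (m := M) (k := 0) D₂.c D₂.hc D₂.d D₂.hd i' tr₂ none
          (μ.mul (lastMult (m := M) (k := 0) D₁.c D₁.hc (D₁.d (some ℓ)) (D₁.hd (some ℓ)) π hπ)) π hπ)) -
      t0 * mid * ZS (χ := χ) (m := M) (k := 0) D₂.c D₂.hc D₂.d D₂.hd i' tr₂ none μ π hπ := by
  rw [JD_succ hrel D₁ D₂ 0 hi' (resid t t0) tr₂ mid μ π hπ]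
  simp only [↓reduceIte, Fintype.sum_option, resid_none, resid_some]
  rw [ZS_congr_mult hrel (m := M) (k := 0) D₂.c D₂.hc D₂.d D₂.hd (fun e _ => D₁.fn_mul_lastMult_none μ π hπ e)]

/-- **`JY` in the active slot, interior, normalised** (`i ≥ 1`). [folklore] -/
theorem JY_succ_resid (D₁ D₂ : DirData ι M) (hc0 : 0 < D₁.c) {t : ι → A} {t0 tT : A} (hF : D₁.Flat R (resid t t0) tT)
    {i : ℕ} (hi : i ≠ 0) {i' : ℕ} (hi' : 0 < i') (tr₂ : Option ι → A) (mid : A) (μ : RFun M)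
    (π : MvPolynomial (Fin M) ℚ) (hπ : IsScale (m := M) (k := 0) π) :
    JY (χ := χ) D₁ D₂ (i + 1) i' (resid t t0) tr₂ mid μ π hπ =
      tT * JZ (χ := χ) D₁ D₂ i i' (resid t t0) tr₂ mid μ π hπ - JZ (χ := χ) D₁ D₂ i i' (resid t t0) tr₂ (tT * mid) μ π hπ +
      ∑ ℓ, (t ℓ * JZ (χ := χ) D₁ D₂ i i' (resid t t0) tr₂ mid (μ.mul (scaleFam (m := M) (k := 0) (D₁.eS ℓ) π hπ)) π hπ -
        JZ (χ := χ) D₁ D₂ i i' (resid t t0) tr₂ (t ℓ * mid) (μ.mul (scaleFam (m := M) (k := 0) (D₁.e0S ℓ) π hπ)) π hπ) := by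
  rw [JY_tfz hrel D₁ D₂ hc0 hF i hi' tr₂ mid μ π hπ]
  simp only [if_neg hi, add_zero, resid_some]

/-- **`JY` in the active slot, boundary `i = 1`, normalised.** [folklore] -/
theorem JY_one_resid (D₁ D₂ : DirData ι M) (hc0 : 0 < D₁.c) {t : ι → A} {t0 tT : A} (hF : D₁.Flat R (resid t t0) tT)
    {i' : ℕ} (hi' : 0 < i') (tr₂ : Option ι → A) (mid : A) (μ : RFun M)
    (π : MvPolynomial (Fin M) ℚ) (hπ : IsScale (m := M) (k := 0) π) :
    JY (χ := χ) D₁ D₂ 1 i' (resid t t0) tr₂ mid μ π hπ =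
      ∑ ℓ, t ℓ * mid * ZS (χ := χ) (m := M) (k := 0) D₂.c D₂.hc D₂.d D₂.hd i' tr₂ none
        (μ.mul (scaleFam (m := M) (k := 0) (D₁.ebrS ℓ) π hπ)) π hπ := by
  rw [JY_tfz hrel D₁ D₂ hc0 hF 0 hi' tr₂ mid μ π hπ]
  have h0 : ∀ (mid' : A) (μ' : RFun M), JZ (χ := χ) D₁ D₂ 0 i' (resid t t0) tr₂ mid' μ' π hπ = 0 := by
    intro mid' μ'
    unfold JZ
    simp only [ZS_zero, zero_mul]
    exact Jsum_zero _ _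
  simp only [↓reduceIte, h0, mul_zero, sub_self, Finset.sum_const_zero, zero_add, resid_some]

omit [IsScalarTower ℚ R A] in
/-- **`JD'` in the active slot 2, interior, normalised** (`i' ≥ 1`). [folklore] -/
theorem JD'_succ_resid (D₁ D₂ : DirData ι M) {i : ℕ} (hi : 0 < i) {i' : ℕ} (hi' : i' ≠ 0) (tr₁ : Option ι → A) (t : ι → A) (t0 : A)
    (mid : A) (μ : RFun M) (π : MvPolynomial (Fin M) ℚ) (hπ : IsScale (m := M) (k := 0) π) :
    JD' (χ := χ) D₁ D₂ i (i' + 1) tr₁ (resid t t0) mid μ π hπ =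
      (JZ' (χ := χ) D₁ D₂ i i' tr₁ (resid t t0) (mid * t0) μ π hπ +
        ∑ ℓ, JZ' (χ := χ) D₁ D₂ i i' tr₁ (resid t t0) (mid * t ℓ)
          (μ.mul (headMult (m := M) (k := 0) D₂.c D₂.hc (D₂.d (some ℓ)) (D₂.hd (some ℓ)) π hπ)) π hπ) -
      JZ' (χ := χ) D₁ D₂ i i' tr₁ (resid t t0) mid μ π hπ * t0 := by
  rw [JD'_succ hrel D₁ D₂ hi i' tr₁ (resid t t0) mid μ π hπ]
  simp only [if_neg hi', Fintype.sum_option, resid_none, resid_some]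
  rw [JZ'_congr_mult hrel D₁ D₂ i i' _ _ (mid * t0) (fun e _ => D₂.fn_mul_headMult_none μ π hπ e)]

omit [IsScalarTower ℚ R A] in
/-- **`JD'` in the active slot 2, boundary `i' = 1`, normalised.** [folklore] -/
theorem JD'_one_resid (D₁ D₂ : DirData ι M) {i : ℕ} (hi : 0 < i) (tr₁ : Option ι → A) (t : ι → A) (t0 : A)
    (mid : A) (μ : RFun M) (π : MvPolynomial (Fin M) ℚ) (hπ : IsScale (m := M) (k := 0) π) :
    JD' (χ := χ) D₁ D₂ i 1 tr₁ (resid t t0) mid μ π hπ =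
      (ZS (χ := χ) (m := M) (k := 0) D₁.c D₁.hc D₁.d D₁.hd i tr₁ none μ π hπ * (mid * t0) +
        ∑ ℓ, ZS (χ := χ) (m := M) (k := 0) D₁.c D₁.hc D₁.d D₁.hd i tr₁ none
          (μ.mul (lastMult (m := M) (k := 0) D₂.c D₂.hc (D₂.d (some ℓ)) (D₂.hd (some ℓ)) π hπ)) π hπ * (mid * t ℓ)) -
      ZS (χ := χ) (m := M) (k := 0) D₁.c D₁.hc D₁.d D₁.hd i tr₁ none μ π hπ * mid * t0 := by
  rw [JD'_succ hrel D₁ D₂ hi 0 tr₁ (resid t t0) mid μ π hπ]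
  simp only [↓reduceIte, Fintype.sum_option, resid_none, resid_some]
  rw [ZS_congr_mult hrel (m := M) (k := 0) D₁.c D₁.hc D₁.d D₁.hd (fun e _ => D₂.fn_mul_lastMult_none μ π hπ e)]

/-- **Expansion of the degree-`p+1` joint sum** `Σ_{i+i'=p+1}(JD + JY + JD')` after one (S)-step:
boundary singles and interior joints in the normalised shapes of the abstract KITE identity. [folklore] -/
theorem joint_expand (D₁ D₂ : DirData ι M) (hc0 : 0 < D₁.c) {t : ι → A} {t0₁ tT₁ : A} (hF : D₁.Flat R (resid t t0₁) tT₁)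
    (t0₂ : A) {p : ℕ} (hp : 0 < p) (μ : RFun M) (π : MvPolynomial (Fin M) ℚ) (hπ : IsScale (m := M) (k := 0) π) :
    Psum (p + 1) (fun i i' =>
        JD (χ := χ) D₁ D₂ i i' (resid t t0₁) (resid t t0₂) 1 μ π hπ + JY (χ := χ) D₁ D₂ i i' (resid t t0₁) (resid t t0₂) 1 μ π hπ +
          JD' (χ := χ) D₁ D₂ i i' (resid t t0₁) (resid t t0₂) 1 μ π hπ) =
      (((t0₁ * ZS (χ := χ) (m := M) (k := 0) D₂.c D₂.hc D₂.d D₂.hd p (resid t t0₂) none μ π hπ +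
          ∑ ℓ, t ℓ * ZS (χ := χ) (m := M) (k := 0) D₂.c D₂.hc D₂.d D₂.hd p (resid t t0₂) none
            (μ.mul (lastMult (m := M) (k := 0) D₁.c D₁.hc (D₁.d (some ℓ)) (D₁.hd (some ℓ)) π hπ)) π hπ) -
          t0₁ * ZS (χ := χ) (m := M) (k := 0) D₂.c D₂.hc D₂.d D₂.hd p (resid t t0₂) none μ π hπ) +
        ((t0₁ * Psum p (fun i i' => JZ (χ := χ) D₁ D₂ i i' (resid t t0₁) (resid t t0₂) 1 μ π hπ) +
          ∑ ℓ, t ℓ * Psum p (fun i i' => JZ (χ := χ) D₁ D₂ i i' (resid t t0₁) (resid t t0₂) 1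
            (μ.mul (headMult (m := M) (k := 0) D₁.c D₁.hc (D₁.d (some ℓ)) (D₁.hd (some ℓ)) π hπ)) π hπ)) -
          Psum p (fun i i' => JZ (χ := χ) D₁ D₂ i i' (resid t t0₁) (resid t t0₂) t0₁ μ π hπ))) +
      ((∑ ℓ, t ℓ * ZS (χ := χ) (m := M) (k := 0) D₂.c D₂.hc D₂.d D₂.hd p (resid t t0₂) none
            (μ.mul (scaleFam (m := M) (k := 0) (D₁.ebrS ℓ) π hπ)) π hπ) +
        (tT₁ * Psum p (fun i i' => JZ (χ := χ) D₁ D₂ i i' (resid t t0₁) (resid t t0₂) 1 μ π hπ) -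
          Psum p (fun i i' => JZ (χ := χ) D₁ D₂ i i' (resid t t0₁) (resid t t0₂) tT₁ μ π hπ) +
          ∑ ℓ, (t ℓ * Psum p (fun i i' => JZ (χ := χ) D₁ D₂ i i' (resid t t0₁) (resid t t0₂) 1
              (μ.mul (scaleFam (m := M) (k := 0) (D₁.eS ℓ) π hπ)) π hπ) -
            Psum p (fun i i' => JZ (χ := χ) D₁ D₂ i i' (resid t t0₁) (resid t t0₂) (t ℓ)
              (μ.mul (scaleFam (m := M) (k := 0) (D₁.e0S ℓ) π hπ)) π hπ)))) +
      (((ZS (χ := χ) (m := M) (k := 0) D₁.c D₁.hc D₁.d D₁.hd p (resid t t0₁) none μ π hπ * t0₂ +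
          ∑ ℓ, ZS (χ := χ) (m := M) (k := 0) D₁.c D₁.hc D₁.d D₁.hd p (resid t t0₁) none
            (μ.mul (lastMult (m := M) (k := 0) D₂.c D₂.hc (D₂.d (some ℓ)) (D₂.hd (some ℓ)) π hπ)) π hπ * t ℓ) -
          ZS (χ := χ) (m := M) (k := 0) D₁.c D₁.hc D₁.d D₁.hd p (resid t t0₁) none μ π hπ * t0₂) +
        ((Psum p (fun i i' => JZ (χ := χ) D₁ D₂ i i' (resid t t0₁) (resid t t0₂) t0₂ μ π hπ) +
          ∑ ℓ, Psum p (fun i i' => JZ (χ := χ) D₁ D₂ i i' (resid t t0₁) (resid t t0₂) (t ℓ)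
            (μ.mul (headMult (m := M) (k := 0) D₂.c D₂.hc (D₂.d (some ℓ)) (D₂.hd (some ℓ)) π hπ)) π hπ)) -
          Psum p (fun i i' => JZ (χ := χ) D₁ D₂ i i' (resid t t0₁) (resid t t0₂) 1 μ π hπ) * t0₂)) := by
  rw [Psum_add, Psum_add, Psum_succ_left hp, Psum_succ_left hp, Psum_succ_right hp,
    JD_one_resid hrel D₁ D₂ hp t t0₁ (resid t t0₂) 1 μ π hπ,
    JY_one_resid hrel D₁ D₂ hc0 hF hp (resid t t0₂) 1 μ π hπ,
    JD'_one_resid hrel D₁ D₂ hp (resid t t0₁) t t0₂ 1 μ π hπ,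
    Psum_congr (fun i i' hi hi' _ => JD_succ_resid hrel D₁ D₂ (Nat.pos_iff_ne_zero.1 hi) hi' t t0₁ (resid t t0₂) 1 μ π hπ),
    Psum_congr (fun i i' hi hi' _ => JY_succ_resid hrel D₁ D₂ hc0 hF (Nat.pos_iff_ne_zero.1 hi) hi' (resid t t0₂) 1 μ π hπ),
    Psum_congr (fun i i' hi hi' _ => (JD'_succ_resid hrel D₁ D₂ hi (Nat.pos_iff_ne_zero.1 hi') (resid t t0₁) t t0₂ 1 μ π hπ).trans
      (by rw [← JZ_eq_JZ' hrel D₁ D₂ hi hi', ← JZ_eq_JZ' hrel D₁ D₂ hi hi',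
            Finset.sum_congr rfl fun ℓ _ => (JZ_eq_JZ' hrel D₁ D₂ hi hi' (resid t t0₁) _ (1 * t ℓ) _ π hπ).symm]))]
  simp only [one_mul, mul_one, Psum_sub, Psum_add, Psum_mul_left, Psum_mul_right, Psum_finset_sum]

omit [Module ℚ A] [IsScalarTower ℚ R A] in
/-- **A scalar identity at the scale point passes to the series**: the `(lM, ĕ, c⁰, c)`-combination. For
series data `Dser`, active data `Da` (scale `q`), degenerate data `Dz`, target data `Db` with
`e_a = c_b`, `e⁰_a = c_z` at the scale point: `q•(ZS[μπ·lM_a] + ZS[μπ·ĕ_a]) + ZS[μ c_z] − ZS[μ c_a] = ZS[μ c_b]`. [folklore] -/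
theorem ZS_scalar_four (Dser Da Dz Db : DirData ι M) (q : ℚ) (hq : Da.c = q) (p : ℕ) (tr : Option ι → A) (ℓ : ι)
    (ρ : RFun M) (π : MvPolynomial (Fin M) ℚ) (hπ : IsScale (m := M) (k := 0) π)
    (hI : ∀ e ∈ KZ.cube (M + 0), (Da.eS ℓ).fn (spt π e) = (headS Db.c Db.hc (Db.d (some ℓ)) (Db.hd (some ℓ))).fn (spt π e))
    (hI0 : ∀ e ∈ KZ.cube (M + 0), (Da.e0S ℓ).fn (spt π e) = (headS Dz.c Dz.hc (Dz.d (some ℓ)) (Dz.hd (some ℓ))).fn (spt π e)) :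
    ZS (χ := χ) (m := M) (k := 0) Dser.c Dser.hc Dser.d Dser.hd p tr none
        (ρ.mul (headMult (m := M) (k := 0) Db.c Db.hc (Db.d (some ℓ)) (Db.hd (some ℓ)) π hπ)) π hπ =
      algebraMap ℚ R q • (ZS (χ := χ) (m := M) (k := 0) Dser.c Dser.hc Dser.d Dser.hd p tr none
            ((ρ.mul (RFun.poly π)).mul (lastMult (m := M) (k := 0) Da.c Da.hc (Da.d (some ℓ)) (Da.hd (some ℓ)) π hπ)) π hπ +
          ZS (χ := χ) (m := M) (k := 0) Dser.c Dser.hc Dser.d Dser.hd p tr none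
            ((ρ.mul (RFun.poly π)).mul (scaleFam (m := M) (k := 0) (Da.ebrS ℓ) π hπ)) π hπ) +
        ZS (χ := χ) (m := M) (k := 0) Dser.c Dser.hc Dser.d Dser.hd p tr none
          (ρ.mul (headMult (m := M) (k := 0) Dz.c Dz.hc (Dz.d (some ℓ)) (Dz.hd (some ℓ)) π hπ)) π hπ -
        ZS (χ := χ) (m := M) (k := 0) Dser.c Dser.hc Dser.d Dser.hd p tr none
          (ρ.mul (headMult (m := M) (k := 0) Da.c Da.hc (Da.d (some ℓ)) (Da.hd (some ℓ)) π hπ)) π hπ := by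
  symm
  rw [ZS_add_mult' hrel (m := M) (k := 0) _ _ _ _ (fun e he => (RFun.fn_add he).symm),
    ZS_const_mul_mult' hrel (m := M) (k := 0) _ _ _ _ q
      (ρ₂ := (RFun.const q).mul (((ρ.mul (RFun.poly π)).mul (lastMult (m := M) (k := 0) Da.c Da.hc (Da.d (some ℓ)) (Da.hd (some ℓ)) π hπ)).add
        ((ρ.mul (RFun.poly π)).mul (scaleFam (m := M) (k := 0) (Da.ebrS ℓ) π hπ))))
      (fun e _ => by rw [RFun.fn_mul, RFun.fn_const]),
    ZS_add_mult' hrel (m := M) (k := 0) _ _ _ _ (fun e he => (RFun.fn_add he).symm)]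
  refine ZS_sub_mult' hrel (m := M) (k := 0) _ _ _ _ (fun e he => ?_) _ _ _ _ _
  have hs := spt_mem hπ he
  rw [RFun.fn_add he, RFun.fn_mul, RFun.fn_const, RFun.fn_add he, lastMult, fn_mul_scaleFam0, fn_mul_scaleFam0, headMult,
    fn_mul_scaleFam0, headMult, fn_mul_scaleFam0, headMult, fn_mul_scaleFam0, RFun.fn_mul, RFun.fn_poly,
    ← Da.ur_mul_fn_lastS ℓ, ← hI e he, ← hI0 e he]
  have h2 := Da.ur_mul_fn_ebrS ℓ hs
  have hq' : ((Da.c : ℚ) : ℝ) = (q : ℝ) := by rw [hq]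
  rw [ur_spt] at h2 ⊢
  rw [hq'] at h2 ⊢
  linear_combination (ρ.fn e) * h2

omit [Module ℚ A] [IsScalarTower ℚ R A] in
/-- **The degenerate-head scalar identity**: `ZS[μ c⁰_z] = q • ZS[μπ lM_z]` (`Dz.c = q`). [folklore] -/
theorem ZS_scalar_two (Dser Dz : DirData ι M) (q : ℚ) (hq : Dz.c = q) (p : ℕ) (tr : Option ι → A) (ℓ : ι)
    (ρ : RFun M) (π : MvPolynomial (Fin M) ℚ) (hπ : IsScale (m := M) (k := 0) π) :
    ZS (χ := χ) (m := M) (k := 0) Dser.c Dser.hc Dser.d Dser.hd p tr none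
        (ρ.mul (headMult (m := M) (k := 0) Dz.c Dz.hc (Dz.d (some ℓ)) (Dz.hd (some ℓ)) π hπ)) π hπ =
      algebraMap ℚ R q • ZS (χ := χ) (m := M) (k := 0) Dser.c Dser.hc Dser.d Dser.hd p tr none
        ((ρ.mul (RFun.poly π)).mul (lastMult (m := M) (k := 0) Dz.c Dz.hc (Dz.d (some ℓ)) (Dz.hd (some ℓ)) π hπ)) π hπ := by
  symm
  refine ZS_const_mul_mult' hrel (m := M) (k := 0) _ _ _ _ q (fun e _ => ?_) _ _ _ _ _
  have hq' : ((Dz.c : ℚ) : ℝ) = (q : ℝ) := by rw [hq]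
  rw [lastMult, fn_mul_scaleFam0, headMult, fn_mul_scaleFam0, RFun.fn_mul, RFun.fn_poly, ← Dz.ur_mul_fn_lastS ℓ, ur_spt, hq']
  ring

omit [Module ℚ A] [IsScalarTower ℚ R A] in
/-- **Identification of a scale-reading factor with a head multiplier** inside `ZS`. [folklore] -/
theorem ZS_ident (Dser Db : DirData ι M) (g : RFun (M + 1)) (p : ℕ) (tr : Option ι → A) (ℓ : ι)
    (ρ : RFun M) (π : MvPolynomial (Fin M) ℚ) (hπ : IsScale (m := M) (k := 0) π)
    (hI : ∀ e ∈ KZ.cube (M + 0), g.fn (spt π e) = (headS Db.c Db.hc (Db.d (some ℓ)) (Db.hd (some ℓ))).fn (spt π e)) :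
    ZS (χ := χ) (m := M) (k := 0) Dser.c Dser.hc Dser.d Dser.hd p tr none (ρ.mul (scaleFam (m := M) (k := 0) g π hπ)) π hπ =
      ZS (χ := χ) (m := M) (k := 0) Dser.c Dser.hc Dser.d Dser.hd p tr none
        (ρ.mul (headMult (m := M) (k := 0) Db.c Db.hc (Db.d (some ℓ)) (Db.hd (some ℓ)) π hπ)) π hπ :=
  ZS_congr_mult hrel (m := M) (k := 0) _ _ _ _ (fun e he => by rw [fn_mul_scaleFam0, headMult, fn_mul_scaleFam0, hI e he]) _ _ _ _ _

omit [IsScalarTower ℚ R A] in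
/-- **Identification inside the joint sum**, with the `π`-weight moved inside: `μ·g ≐ (ρ c_b)·π` for
`μ = ρπ`. [folklore] -/
theorem Psum_JZ_ident_poly (D₁ D₂ Db : DirData ι M) (g : RFun (M + 1)) (p : ℕ) (t₁ t₂ : Option ι → A) (mid : A) (ℓ : ι)
    (μ ρ : RFun M) (π : MvPolynomial (Fin M) ℚ) (hμ : μ = ρ.mul (RFun.poly π)) (hπ : IsScale (m := M) (k := 0) π)
    (hI : ∀ e ∈ KZ.cube (M + 0), g.fn (spt π e) = (headS Db.c Db.hc (Db.d (some ℓ)) (Db.hd (some ℓ))).fn (spt π e)) :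
    Psum p (fun i i' => JZ (χ := χ) D₁ D₂ i i' t₁ t₂ mid (μ.mul (scaleFam (m := M) (k := 0) g π hπ)) π hπ) =
      Psum p (fun i i' => JZ (χ := χ) D₁ D₂ i i' t₁ t₂ mid
        ((ρ.mul (headMult (m := M) (k := 0) Db.c Db.hc (Db.d (some ℓ)) (Db.hd (some ℓ)) π hπ)).mul (RFun.poly π)) π hπ) := by
  subst hμ
  exact Psum_congr fun _ _ _ _ _ => JZ_congr_mult hrel _ _ _ _ _ _ _ (fun e he => by
    rw [fn_mul_scaleFam0, RFun.fn_mul, RFun.fn_poly, RFun.fn_mul, headMult, fn_mul_scaleFam0, hI e he, RFun.fn_poly]; ring) _ _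

omit [IsScalarTower ℚ R A] in
/-- **Identification inside the joint sum**, `π`-weight kept in front: `μπ·g ≐ μπ·c_b`. [folklore] -/
theorem Psum_JZ_ident (D₁ D₂ Db : DirData ι M) (g : RFun (M + 1)) (p : ℕ) (t₁ t₂ : Option ι → A) (mid : A) (ℓ : ι)
    (μ : RFun M) (π : MvPolynomial (Fin M) ℚ) (hπ : IsScale (m := M) (k := 0) π)
    (hI : ∀ e ∈ KZ.cube (M + 0), g.fn (spt π e) = (headS Db.c Db.hc (Db.d (some ℓ)) (Db.hd (some ℓ))).fn (spt π e)) :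
    Psum p (fun i i' => JZ (χ := χ) D₁ D₂ i i' t₁ t₂ mid (μ.mul (scaleFam (m := M) (k := 0) g π hπ)) π hπ) =
      Psum p (fun i i' => JZ (χ := χ) D₁ D₂ i i' t₁ t₂ mid
        (μ.mul (headMult (m := M) (k := 0) Db.c Db.hc (Db.d (some ℓ)) (Db.hd (some ℓ)) π hπ)) π hπ) :=
  Psum_congr fun _ _ _ _ _ => JZ_congr_mult hrel _ _ _ _ _ _ _ (fun e he => by
    rw [fn_mul_scaleFam0, headMult, fn_mul_scaleFam0, hI e he]) _ _

omit [IsScalarTower ℚ R A] in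
/-- **Moving the `π`-weight inside a head multiplier** in the joint sum: `μ·c ≐ (ρ c)·π` for `μ = ρπ`. [folklore] -/
theorem Psum_JZ_poly_comm (D₁ D₂ Db : DirData ι M) (p : ℕ) (t₁ t₂ : Option ι → A) (mid : A) (ℓ : ι)
    (μ ρ : RFun M) (π : MvPolynomial (Fin M) ℚ) (hμ : μ = ρ.mul (RFun.poly π)) (hπ : IsScale (m := M) (k := 0) π) :
    Psum p (fun i i' => JZ (χ := χ) D₁ D₂ i i' t₁ t₂ mid
        (μ.mul (headMult (m := M) (k := 0) Db.c Db.hc (Db.d (some ℓ)) (Db.hd (some ℓ)) π hπ)) π hπ) =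
      Psum p (fun i i' => JZ (χ := χ) D₁ D₂ i i' t₁ t₂ mid
        ((ρ.mul (headMult (m := M) (k := 0) Db.c Db.hc (Db.d (some ℓ)) (Db.hd (some ℓ)) π hπ)).mul (RFun.poly π)) π hπ) := by
  subst hμ
  exact Psum_congr fun _ _ _ _ _ => JZ_congr_mult hrel _ _ _ _ _ _ _ (fun e _ => by
    rw [headMult, RFun.fn_mul, RFun.fn_mul, RFun.fn_poly, RFun.fn_mul, RFun.fn_mul, RFun.fn_poly]; ring) _ _

end KiteExpand


/-! ## The (S)-steps with a prescribed scale proof at the new stage -/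

section DiagPrimed

open Shuffle NCSeries

variable {R : Type} [CommRing R] [Algebra ℚ R] {χ : KZ.FormalRep →+ R} (hrel : ∀ c ∈ KZ.relations, χ c = 0)
variable {ι : Type} [Fintype ι] [DecidableEq ι] {m k : ℕ}
variable {A : Type} [Ring A] [Algebra R A] [Module ℚ A] [IsScalarTower ℚ R A]

include hrel

omit [Module ℚ A] [IsScalarTower ℚ R A] in
/-- `ZS_substY_diag_S` with the new-stage scale proof prescribed. [folklore] -/
theorem DirData.ZS_substY_diag_S' (Δ₁ : DirData ι (m + 1)) (hD : Δ₁.IsDeriv) (j : ℕ) (t : Option ι → A) (ρ : RFun (m + k))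
    (π : MvPolynomial (Fin (m + k)) ℚ) (hπ : IsScale π) (hπ' : IsScale (m := m + (k + 1)) (k := 0) (scaleMul π)) :
    ZS (χ := χ) (m := m + k) (k := 0) (Δ₁.substY π hπ).c (Δ₁.substY π hπ).hc (Δ₁.substY π hπ).d (Δ₁.substY π hπ).hd j t none ρ π hπ =
      DS (χ := χ) (m := m + (k + 1)) (k := 0) (Δ₁.substY (k := k + 1) (scaleMul π) hπ').c
          (Δ₁.substY (k := k + 1) (scaleMul π) hπ').hc (Δ₁.substY (k := k + 1) (scaleMul π) hπ').d
          (Δ₁.substY (k := k + 1) (scaleMul π) hπ').hd j t none ρ.lift (scaleMul π) hπ' +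
        (Δ₁.substY (k := k + 1) (scaleMul π) hπ').YS (χ := χ) (k := 0) j t ρ.lift (scaleMul π) hπ' :=
  Δ₁.ZS_substY_diag_S hrel hD j t ρ π hπ

/-- `JZ_substY_diag_S` with the new-stage scale proof prescribed. [folklore] -/
theorem JZ_substY_diag_S' (Δ₁ Δ₂ : DirData ι (m + 1)) (hD₁ : Δ₁.IsDeriv) (hD₂ : Δ₂.IsDeriv) (hF₂ : Δ₂.DerivFree)
    {i i' : ℕ} (hi : 0 < i) (hi' : 0 < i') (t₁ t₂ : Option ι → A) (ρ : RFun (m + k)) (π : MvPolynomial (Fin (m + k)) ℚ)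
    (hπ : IsScale π) (hπ' : IsScale (m := m + (k + 1)) (k := 0) (scaleMul π)) :
    JZ (χ := χ) (M := m + k) (Δ₁.substY π hπ) (Δ₂.substY π hπ) i i' t₁ t₂ 1 (ρ.mul (RFun.poly π)) π hπ =
      JD (χ := χ) (M := m + (k + 1)) (Δ₁.substY (k := k + 1) (scaleMul π) hπ') (Δ₂.substY (k := k + 1) (scaleMul π) hπ') i i' t₁ t₂ 1
          (RFun.mul (M := m + (k + 1)) ρ.lift (RFun.poly (scaleMul π))) (scaleMul π) hπ' +
      JY (χ := χ) (M := m + (k + 1)) (Δ₁.substY (k := k + 1) (scaleMul π) hπ') (Δ₂.substY (k := k + 1) (scaleMul π) hπ') i i' t₁ t₂ 1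
          (RFun.mul (M := m + (k + 1)) ρ.lift (RFun.poly (scaleMul π))) (scaleMul π) hπ' +
      JD' (χ := χ) (M := m + (k + 1)) (Δ₁.substY (k := k + 1) (scaleMul π) hπ') (Δ₂.substY (k := k + 1) (scaleMul π) hπ') i i' t₁ t₂ 1
          (RFun.mul (M := m + (k + 1)) ρ.lift (RFun.poly (scaleMul π))) (scaleMul π) hπ' :=
  JZ_substY_diag_S hrel Δ₁ Δ₂ hD₁ hD₂ hF₂ hi hi' t₁ t₂ ρ π hπ

end DiagPrimed

/-! ## The KITE: the induction step -/

section KiteStep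

open Shuffle NCSeries

variable {R : Type} [CommRing R] [Algebra ℚ R] {χ : KZ.FormalRep →+ R} (hrel : ∀ c ∈ KZ.relations, χ c = 0)
variable {ι : Type} [Fintype ι] [DecidableEq ι] {m : ℕ}
variable {A : Type} [Ring A] [Algebra R A] [Module ℚ A] [IsScalarTower ℚ R A]

namespace KiteData

variable (K : KiteData ι m) {ab bb : ℚ} {t : ι → A} {tX tY : A}

include hrel

/-- **The KITE induction step.** If `𝒲_p ≡ 0` (all rider counts and multipliers, `p ≥ 1`) then
`𝒲_{p+1} ≡ 0`. [folklore] -/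
theorem kite_succ (H : K.Hyp R ab bb t tX tY) {p : ℕ} (hp : 0 < p)
    (ih : ∀ (k : ℕ) (ρ : RFun (m + k)) (π : MvPolynomial (Fin (m + k)) ℚ) (hπ : IsScale π), K.W (χ := χ) ab bb t tX tY p ρ π hπ = 0)
    (k : ℕ) (ρ : RFun (m + k)) (π : MvPolynomial (Fin (m + k)) ℚ) (hπ : IsScale π) :
    K.W (χ := χ) ab bb t tX tY (p + 1) ρ π hπ = 0 := by
  have hp0 : p ≠ 0 := hp.ne'
  have hπ' : IsScale (m := m + (k + 1)) (k := 0) (scaleMul π) := isScale_scaleMul hπ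
  -- the stage-`⁺` data
  set Dy' : DirData ι (m + (k + 1)) := K.Dy.substY (k := k + 1) (scaleMul π) hπ' with hDy'
  set Dx' : DirData ι (m + (k + 1)) := K.Dx.substY (k := k + 1) (scaleMul π) hπ' with hDx'
  set D0y' : DirData ι (m + (k + 1)) := K.D0y.substY (k := k + 1) (scaleMul π) hπ' with hD0y'
  set D0x' : DirData ι (m + (k + 1)) := K.D0x.substY (k := k + 1) (scaleMul π) hπ' with hD0x'
  -- scales and hypotheses at stage `⁺`
  have hcy : (0 : ℚ) < Dy'.c := by rw [show Dy'.c = K.Dy.c from rfl, H.cy]; exact H.hbb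
  have hcx : (0 : ℚ) < Dx'.c := by rw [show Dx'.c = K.Dx.c from rfl, H.cx]; exact H.hab
  have hc0y : (0 : ℚ) < D0y'.c := by rw [show D0y'.c = K.D0y.c from rfl, H.c0y]; exact H.hbb
  have hc0x : (0 : ℚ) < D0x'.c := by rw [show D0x'.c = K.D0x.c from rfl, H.c0x]; exact H.hab
  have flY : Dy'.Flat R (resid t tY) tX := H.flatY (k + 1) (scaleMul π) hπ'
  have flX : Dx'.Flat R (resid t tX) tY := H.flatX (k + 1) (scaleMul π) hπ'
  have axY : D0y'.AxisComm R (resid t tY) tX := H.ax0y (k + 1) (scaleMul π) hπ'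
  have axX : D0x'.AxisComm R (resid t tX) tY := H.ax0x (k + 1) (scaleMul π) hπ'
  have hIy : ∀ ℓ (e : Fin ((m + (k + 1)) + 0) → ℝ), e ∈ KZ.cube ((m + (k + 1)) + 0) →
      (Dy'.eS ℓ).fn (spt (scaleMul π) e) = (headS Dx'.c Dx'.hc (Dx'.d (some ℓ)) (Dx'.hd (some ℓ))).fn (spt (scaleMul π) e) :=
    fun ℓ e he => H.Iy (k + 1) (scaleMul π) hπ' ℓ e he
  have hIx : ∀ ℓ (e : Fin ((m + (k + 1)) + 0) → ℝ), e ∈ KZ.cube ((m + (k + 1)) + 0) →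
      (Dx'.eS ℓ).fn (spt (scaleMul π) e) = (headS Dy'.c Dy'.hc (Dy'.d (some ℓ)) (Dy'.hd (some ℓ))).fn (spt (scaleMul π) e) :=
    fun ℓ e he => H.Ix (k + 1) (scaleMul π) hπ' ℓ e he
  have hIy0 : ∀ ℓ (e : Fin ((m + (k + 1)) + 0) → ℝ), e ∈ KZ.cube ((m + (k + 1)) + 0) →
      (Dy'.e0S ℓ).fn (spt (scaleMul π) e) = (headS D0x'.c D0x'.hc (D0x'.d (some ℓ)) (D0x'.hd (some ℓ))).fn (spt (scaleMul π) e) :=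
    fun ℓ e he => H.Iy0 (k + 1) (scaleMul π) hπ' ℓ e he
  have hIx0 : ∀ ℓ (e : Fin ((m + (k + 1)) + 0) → ℝ), e ∈ KZ.cube ((m + (k + 1)) + 0) →
      (Dx'.e0S ℓ).fn (spt (scaleMul π) e) = (headS D0y'.c D0y'.hc (D0y'.d (some ℓ)) (D0y'.hd (some ℓ))).fn (spt (scaleMul π) e) :=
    fun ℓ e he => H.Ix0 (k + 1) (scaleMul π) hπ' ℓ e he
  ------------------------------------------------------------------
  -- Step 1: (S) at `π`
  ------------------------------------------------------------------
  have eY := K.Dy.ZS_substY_diag_S' hrel (A := A) H.dy (p + 1) (resid t tY) ρ π hπ hπ'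
  have eX := K.Dx.ZS_substY_diag_S' hrel (A := A) H.dx (p + 1) (resid t tX) ρ π hπ hπ'
  have eY0 := K.D0y.ZS_substY_diag_S' hrel (A := A) H.d0y (p + 1) (resid t tY) ρ π hπ hπ'
  have eX0 := K.D0x.ZS_substY_diag_S' hrel (A := A) H.d0x (p + 1) (resid t tX) ρ π hπ hπ'
  rw [D0y'.YS_eq_zero_of_derivFree hrel (H.f0y.substY _ _), add_zero] at eY0
  rw [D0x'.YS_eq_zero_of_derivFree hrel (H.f0x.substY _ _), add_zero] at eX0
  have eJ : Psum (p + 1) (fun i i' =>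
      JZ (χ := χ) (M := m + k) (K.Dy.substY π hπ) (K.D0x.substY π hπ) i i' (resid t tY) (resid t tX) 1 (ρ.mul (RFun.poly π)) π hπ -
      JZ (χ := χ) (M := m + k) (K.Dx.substY π hπ) (K.D0y.substY π hπ) i i' (resid t tX) (resid t tY) 1 (ρ.mul (RFun.poly π)) π hπ) =
      Psum (p + 1) (fun i i' =>
        (JD (χ := χ) Dy' D0x' i i' (resid t tY) (resid t tX) 1 (RFun.mul (M := m + (k + 1)) ρ.lift (RFun.poly (scaleMul π))) (scaleMul π) hπ' +
          JY (χ := χ) Dy' D0x' i i' (resid t tY) (resid t tX) 1 (RFun.mul (M := m + (k + 1)) ρ.lift (RFun.poly (scaleMul π))) (scaleMul π) hπ' +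
          JD' (χ := χ) Dy' D0x' i i' (resid t tY) (resid t tX) 1 (RFun.mul (M := m + (k + 1)) ρ.lift (RFun.poly (scaleMul π))) (scaleMul π) hπ') -
        (JD (χ := χ) Dx' D0y' i i' (resid t tX) (resid t tY) 1 (RFun.mul (M := m + (k + 1)) ρ.lift (RFun.poly (scaleMul π))) (scaleMul π) hπ' +
          JY (χ := χ) Dx' D0y' i i' (resid t tX) (resid t tY) 1 (RFun.mul (M := m + (k + 1)) ρ.lift (RFun.poly (scaleMul π))) (scaleMul π) hπ' +
          JD' (χ := χ) Dx' D0y' i i' (resid t tX) (resid t tY) 1 (RFun.mul (M := m + (k + 1)) ρ.lift (RFun.poly (scaleMul π))) (scaleMul π) hπ')) :=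
    Psum_congr fun i i' hi hi' _ => by
      rw [JZ_substY_diag_S' hrel K.Dy K.D0x H.dy H.d0x H.f0x hi hi' _ _ ρ π hπ hπ', JZ_substY_diag_S' hrel K.Dx K.D0y H.dx H.d0y H.f0y hi hi' _ _ ρ π hπ hπ']
  ------------------------------------------------------------------
  -- Step 2: expansions at stage `⁺`, identifications
  ------------------------------------------------------------------
  have sY := Dy'.DS_succ_resid hrel (A := A) hp0 t tY ρ.lift (scaleMul π) hπ'
  have sYt := Dy'.YS_succ_resid hrel hcy flY hp0 ρ.lift (scaleMul π) hπ'
  have sX := Dx'.DS_succ_resid hrel (A := A) hp0 t tX ρ.lift (scaleMul π) hπ'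
  have sXt := Dx'.YS_succ_resid hrel hcx flX hp0 ρ.lift (scaleMul π) hπ'
  have sY0 := D0y'.DS_succ_resid hrel (A := A) hp0 t tY ρ.lift (scaleMul π) hπ'
  have sX0 := D0x'.DS_succ_resid hrel (A := A) hp0 t tX ρ.lift (scaleMul π) hπ'
  have jP := joint_expand hrel Dy' D0x' hcy flY tX hp (RFun.mul (M := m + (k + 1)) ρ.lift (RFun.poly (scaleMul π))) (scaleMul π) hπ'
  have jN := joint_expand hrel Dx' D0y' hcx flX tY hp (RFun.mul (M := m + (k + 1)) ρ.lift (RFun.poly (scaleMul π))) (scaleMul π) hπ'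
  -- identifications of the transverse coefficients (singles)
  have idY := fun ℓ => ZS_ident hrel (A := A) Dy' Dx' (Dy'.eS ℓ) p (resid t tY) ℓ ρ.lift (scaleMul π) hπ' (hIy ℓ)
  have idY0 := fun ℓ => ZS_ident hrel (A := A) Dy' D0x' (Dy'.e0S ℓ) p (resid t tY) ℓ ρ.lift (scaleMul π) hπ' (hIy0 ℓ)
  have idX := fun ℓ => ZS_ident hrel (A := A) Dx' Dy' (Dx'.eS ℓ) p (resid t tX) ℓ ρ.lift (scaleMul π) hπ' (hIx ℓ)
  have idX0 := fun ℓ => ZS_ident hrel (A := A) Dx' D0y' (Dx'.e0S ℓ) p (resid t tX) ℓ ρ.lift (scaleMul π) hπ' (hIx0 ℓ)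
  -- identifications / realignments of the joint multipliers
  have jdPe := fun ℓ => Psum_JZ_ident_poly hrel Dy' D0x' Dx' (Dy'.eS ℓ) p (resid t tY) (resid t tX) 1 ℓ (RFun.mul (M := m + (k + 1)) ρ.lift (RFun.poly (scaleMul π))) ρ.lift (scaleMul π) rfl
    hπ' (hIy ℓ)
  have jdPc := fun ℓ => Psum_JZ_poly_comm hrel Dy' D0x' Dy' p (resid t tY) (resid t tX) (1 : A) ℓ (RFun.mul (M := m + (k + 1)) ρ.lift (RFun.poly (scaleMul π))) ρ.lift (scaleMul π) rfl hπ'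
  have jdPe0 := fun ℓ => Psum_JZ_ident hrel Dy' D0x' D0x' (Dy'.e0S ℓ) p (resid t tY) (resid t tX) (t ℓ) ℓ
    (RFun.mul (M := m + (k + 1)) ρ.lift (RFun.poly (scaleMul π))) (scaleMul π) hπ' (hIy0 ℓ)
  have jdNe := fun ℓ => Psum_JZ_ident_poly hrel Dx' D0y' Dy' (Dx'.eS ℓ) p (resid t tX) (resid t tY) 1 ℓ (RFun.mul (M := m + (k + 1)) ρ.lift (RFun.poly (scaleMul π))) ρ.lift (scaleMul π) rfl
    hπ' (hIx ℓ)
  have jdNc := fun ℓ => Psum_JZ_poly_comm hrel Dx' D0y' Dx' p (resid t tX) (resid t tY) (1 : A) ℓ (RFun.mul (M := m + (k + 1)) ρ.lift (RFun.poly (scaleMul π))) ρ.lift (scaleMul π) rfl hπ'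
  have jdNe0 := fun ℓ => Psum_JZ_ident hrel Dx' D0y' D0y' (Dx'.e0S ℓ) p (resid t tX) (resid t tY) (t ℓ) ℓ
    (RFun.mul (M := m + (k + 1)) ρ.lift (RFun.poly (scaleMul π))) (scaleMul π) hπ' (hIx0 ℓ)
  -- the four scalar identities
  have hsX0 := fun ℓ => ZS_scalar_four hrel (A := A) D0x' Dy' D0x' Dx' bb H.cy p (resid t tX) ℓ ρ.lift (scaleMul π) hπ'
    (hIy ℓ) (hIy0 ℓ)
  have hsY0' := fun ℓ => ZS_scalar_four hrel (A := A) D0y' Dx' D0y' Dy' ab H.cx p (resid t tY) ℓ ρ.lift (scaleMul π) hπ'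
    (hIx ℓ) (hIx0 ℓ)
  have hsY0 : ∀ ℓ, ZS (χ := χ) (m := m + (k + 1)) (k := 0) D0y'.c D0y'.hc D0y'.d D0y'.hd p (resid t tY) none
        (RFun.mul (M := m + (k + 1)) ρ.lift (headMult (m := m + (k + 1)) (k := 0) Dx'.c Dx'.hc (Dx'.d (some ℓ)) (Dx'.hd (some ℓ)) (scaleMul π) hπ')) (scaleMul π) hπ' =
      algebraMap ℚ R ab • (ZS (χ := χ) (m := m + (k + 1)) (k := 0) D0y'.c D0y'.hc D0y'.d D0y'.hd p (resid t tY) none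
            ((RFun.mul (M := m + (k + 1)) ρ.lift (RFun.poly (scaleMul π))).mul (lastMult (m := m + (k + 1)) (k := 0) Dx'.c Dx'.hc (Dx'.d (some ℓ)) (Dx'.hd (some ℓ))
              (scaleMul π) hπ')) (scaleMul π) hπ' +
          ZS (χ := χ) (m := m + (k + 1)) (k := 0) D0y'.c D0y'.hc D0y'.d D0y'.hd p (resid t tY) none
            ((RFun.mul (M := m + (k + 1)) ρ.lift (RFun.poly (scaleMul π))).mul (scaleFam (m := m + (k + 1)) (k := 0) (Dx'.ebrS ℓ) (scaleMul π) hπ')) (scaleMul π) hπ') +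
        ZS (χ := χ) (m := m + (k + 1)) (k := 0) D0y'.c D0y'.hc D0y'.d D0y'.hd p (resid t tY) none
          (RFun.mul (M := m + (k + 1)) ρ.lift (headMult (m := m + (k + 1)) (k := 0) D0y'.c D0y'.hc (D0y'.d (some ℓ)) (D0y'.hd (some ℓ)) (scaleMul π) hπ')) (scaleMul π) hπ' -
        ZS (χ := χ) (m := m + (k + 1)) (k := 0) D0y'.c D0y'.hc D0y'.d D0y'.hd p (resid t tY) none
          (RFun.mul (M := m + (k + 1)) ρ.lift (headMult (m := m + (k + 1)) (k := 0) Dy'.c Dy'.hc (Dy'.d (some ℓ)) (Dy'.hd (some ℓ)) (scaleMul π) hπ')) (scaleMul π) hπ' :=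
    fun ℓ => by rw [hsY0' ℓ]; module
  have hsX := fun ℓ => ZS_scalar_two hrel (A := A) Dx' D0y' bb H.c0y p (resid t tX) ℓ ρ.lift (scaleMul π) hπ'
  have hsY := fun ℓ => ZS_scalar_two hrel (A := A) Dy' D0x' ab H.c0x p (resid t tY) ℓ ρ.lift (scaleMul π) hπ'
  -- the induction hypothesis at stage `⁺`, at the base multiplier and at the head multipliers
  have ihW : ∀ μ : RFun (m + (k + 1)), K.W (χ := χ) ab bb t tX tY p μ (scaleMul π) hπ' = 0 :=
    fun μ => ih (k + 1) μ (scaleMul π) hπ'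
  have hW1 := ihW ρ.lift
  have hWx := fun ℓ => ihW (RFun.mul (M := m + (k + 1)) ρ.lift (headMult (m := m + (k + 1)) (k := 0) Dx'.c Dx'.hc (Dx'.d (some ℓ)) (Dx'.hd (some ℓ))
    (scaleMul π) hπ'))
  have hWy := fun ℓ => ihW (RFun.mul (M := m + (k + 1)) ρ.lift (headMult (m := m + (k + 1)) (k := 0) Dy'.c Dy'.hc (Dy'.d (some ℓ)) (Dy'.hd (some ℓ))
    (scaleMul π) hπ'))
  unfold W at hW1 hWx hWy
  rw [Psum_sub] at hW1
  simp only [Psum_sub, ← hDy', ← hDx', ← hD0y', ← hD0x'] at hWx hWy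
  -- the junk vanishes by axis commutation
  have jk1 : tX * ZS (χ := χ) (m := m + (k + 1)) (k := 0) D0y'.c D0y'.hc D0y'.d D0y'.hd p (resid t tY) none ρ.lift (scaleMul π) hπ' -
      ZS (χ := χ) (m := m + (k + 1)) (k := 0) D0y'.c D0y'.hc D0y'.d D0y'.hd p (resid t tY) none ρ.lift (scaleMul π) hπ' * tX = 0 :=
    sub_eq_zero.2 (D0y'.comm_ZS_of_axisComm hrel hc0y axY p 0 ρ.lift (scaleMul π) hπ')
  have jk2 : tY * ZS (χ := χ) (m := m + (k + 1)) (k := 0) D0x'.c D0x'.hc D0x'.d D0x'.hd p (resid t tX) none ρ.lift (scaleMul π) hπ' -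
      ZS (χ := χ) (m := m + (k + 1)) (k := 0) D0x'.c D0x'.hc D0x'.d D0x'.hd p (resid t tX) none ρ.lift (scaleMul π) hπ' * tY = 0 :=
    sub_eq_zero.2 (D0x'.comm_ZS_of_axisComm hrel hc0x axX p 0 ρ.lift (scaleMul π) hπ')
  have jk3 : Psum p (fun i i' => JZ (χ := χ) Dy' D0x' i i' (resid t tY) (resid t tX) 1 (RFun.mul (M := m + (k + 1)) ρ.lift (RFun.poly (scaleMul π))) (scaleMul π)
        hπ') * tY -
      Psum p (fun i i' => JZ (χ := χ) Dy' D0x' i i' (resid t tY) (resid t tX) tY (RFun.mul (M := m + (k + 1)) ρ.lift (RFun.poly (scaleMul π))) (scaleMul π)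
        hπ') = 0 := by
    rw [← Psum_mul_right, ← Psum_sub, ← Psum_zero (A := A) p]
    refine Psum_congr fun i i' hi hi' _ => ?_
    rw [JZ_eq_JZ' hrel Dy' D0x' hi hi', JZ_eq_JZ' hrel Dy' D0x' hi hi', JZ', JZ', ← Jsum'_mul_right, ← Jsum'_sub, ← Jsum'_zero (A := A) i (resid t tY)]
    refine Jsum'_congr fun u => ?_
    rw [one_mul, sub_eq_zero]
    exact (D0x'.comm_ZS_of_axisComm hrel hc0x axX i' u.length _ _ _).symm
  have jk4 : Psum p (fun i i' => JZ (χ := χ) Dx' D0y' i i' (resid t tX) (resid t tY) tX (RFun.mul (M := m + (k + 1)) ρ.lift (RFun.poly (scaleMul π))) (scaleMul π)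
        hπ') -
      Psum p (fun i i' => JZ (χ := χ) Dx' D0y' i i' (resid t tX) (resid t tY) 1 (RFun.mul (M := m + (k + 1)) ρ.lift (RFun.poly (scaleMul π))) (scaleMul π)
        hπ') * tX = 0 := by
    rw [← Psum_mul_right, ← Psum_sub, ← Psum_zero (A := A) p]
    refine Psum_congr fun i i' hi hi' _ => ?_
    rw [JZ_eq_JZ' hrel Dx' D0y' hi hi', JZ_eq_JZ' hrel Dx' D0y' hi hi', JZ', JZ', ← Jsum'_mul_right, ← Jsum'_sub, ← Jsum'_zero (A := A) i (resid t tX)]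
    refine Jsum'_congr fun u => ?_
    rw [one_mul, sub_eq_zero]
    exact D0y'.comm_ZS_of_axisComm hrel hc0y axY i' u.length _ _ _
  ------------------------------------------------------------------
  -- Step 3: assemble the expansion, apply the abstract identity
  ------------------------------------------------------------------
  unfold W
  rw [eY, eX, eY0, eX0, eJ, sY, sYt, sX, sXt, sY0, sX0, Psum_sub, jP, jN]
  simp only [idY, idY0, idX, idX0, jdPe, jdPc, jdPe0, jdNe, jdNc, jdNe0]
  rw [kite_abs (algebraMap ℚ R ab) (algebraMap ℚ R bb) t tX tY _ _ _ _ _ _ _ _ _ _ _ _ _ _ _ _ _ _ _ _ _ _ _ _ _ _ _ _ _ _ _ _ _ _ _ _ _ _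
    hsX0 hsY0 hsX hsY]
  rw [hW1]
  simp only [hWx, hWy, jk1, jk2, jk3, jk4, mul_zero, zero_mul, sub_self, add_zero, smul_zero, Finset.sum_const_zero]

/-- **The KITE base** (degree `1`). [folklore] -/
theorem kite_one (H : K.Hyp R ab bb t tX tY) (k : ℕ) (ρ : RFun (m + k)) (π : MvPolynomial (Fin (m + k)) ℚ) (hπ : IsScale π) :
    K.W (χ := χ) ab bb t tX tY 1 ρ π hπ = 0 := by
  have hπ' : IsScale (m := m + (k + 1)) (k := 0) (scaleMul π) := isScale_scaleMul hπ
  set Dy' : DirData ι (m + (k + 1)) := K.Dy.substY (k := k + 1) (scaleMul π) hπ' with hDy'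
  set Dx' : DirData ι (m + (k + 1)) := K.Dx.substY (k := k + 1) (scaleMul π) hπ' with hDx'
  set D0y' : DirData ι (m + (k + 1)) := K.D0y.substY (k := k + 1) (scaleMul π) hπ' with hD0y'
  set D0x' : DirData ι (m + (k + 1)) := K.D0x.substY (k := k + 1) (scaleMul π) hπ' with hD0x'
  have hcy : (0 : ℚ) < Dy'.c := by rw [show Dy'.c = K.Dy.c from rfl, H.cy]; exact H.hbb
  have hcx : (0 : ℚ) < Dx'.c := by rw [show Dx'.c = K.Dx.c from rfl, H.cx]; exact H.hab
  have flY : Dy'.Flat R (resid t tY) tX := H.flatY (k + 1) (scaleMul π) hπ'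
  have flX : Dx'.Flat R (resid t tX) tY := H.flatX (k + 1) (scaleMul π) hπ'
  -- (S) and the degree-one expansions
  have eY := K.Dy.ZS_substY_diag_S' hrel (A := A) H.dy 1 (resid t tY) ρ π hπ hπ'
  have eX := K.Dx.ZS_substY_diag_S' hrel (A := A) H.dx 1 (resid t tX) ρ π hπ hπ'
  have eY0 := K.D0y.ZS_substY_diag_S' hrel (A := A) H.d0y 1 (resid t tY) ρ π hπ hπ'
  have eX0 := K.D0x.ZS_substY_diag_S' hrel (A := A) H.d0x 1 (resid t tX) ρ π hπ hπ'
  rw [D0y'.YS_eq_zero_of_derivFree hrel (H.f0y.substY _ _), add_zero] at eY0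
  rw [D0x'.YS_eq_zero_of_derivFree hrel (H.f0x.substY _ _), add_zero] at eX0
  have sY := Dy'.DS_one_resid hrel (A := A) t tY ρ.lift (scaleMul π) hπ'
  have sYt := Dy'.YS_one_resid hrel hcy flY ρ.lift (scaleMul π) hπ'
  have sX := Dx'.DS_one_resid hrel (A := A) t tX ρ.lift (scaleMul π) hπ'
  have sXt := Dx'.YS_one_resid hrel hcx flX ρ.lift (scaleMul π) hπ'
  have sY0 := D0y'.DS_one_resid hrel (A := A) t tY ρ.lift (scaleMul π) hπ'
  have sX0 := D0x'.DS_one_resid hrel (A := A) t tX ρ.lift (scaleMul π) hπ'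
  -- the scalar identity behind the base: the combined multiplier vanishes at the scale point
  have hkey : ∀ ℓ, algebraMap ℚ R bb *
      ((RFun.mul (M := m + (k + 1)) ρ.lift (lastMult (m := m + (k + 1)) (k := 0) Dy'.c Dy'.hc (Dy'.d (some ℓ)) (Dy'.hd (some ℓ)) (scaleMul π) hπ')).chi χ +
        (RFun.mul (M := m + (k + 1)) ρ.lift (scaleFam (m := m + (k + 1)) (k := 0) (Dy'.ebrS ℓ) (scaleMul π) hπ')).chi χ -
        (RFun.mul (M := m + (k + 1)) ρ.lift (lastMult (m := m + (k + 1)) (k := 0) D0y'.c D0y'.hc (D0y'.d (some ℓ)) (D0y'.hd (some ℓ)) (scaleMul π) hπ')).chi χ) =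
      algebraMap ℚ R ab *
      ((RFun.mul (M := m + (k + 1)) ρ.lift (lastMult (m := m + (k + 1)) (k := 0) Dx'.c Dx'.hc (Dx'.d (some ℓ)) (Dx'.hd (some ℓ)) (scaleMul π) hπ')).chi χ +
        (RFun.mul (M := m + (k + 1)) ρ.lift (scaleFam (m := m + (k + 1)) (k := 0) (Dx'.ebrS ℓ) (scaleMul π) hπ')).chi χ -
        (RFun.mul (M := m + (k + 1)) ρ.lift (lastMult (m := m + (k + 1)) (k := 0) D0x'.c D0x'.hc (D0x'.d (some ℓ)) (D0x'.hd (some ℓ)) (scaleMul π) hπ')).chi χ) := by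
    intro ℓ
    rw [← RFun.chi_add hrel, ← RFun.chi_sub hrel, ← RFun.chi_const_mul hrel, ← RFun.chi_add hrel, ← RFun.chi_sub hrel,
      ← RFun.chi_const_mul hrel, ← sub_eq_zero, ← RFun.chi_sub hrel]
    refine RFun.chi_eq_zero hrel fun e he => ?_
    have hB := H.B1 (k + 1) (scaleMul π) hπ' ℓ e he
    rw [RFun.fn_sub he, RFun.fn_mul, RFun.fn_const, RFun.fn_mul, RFun.fn_const, RFun.fn_sub he, RFun.fn_sub he, RFun.fn_add he,
      RFun.fn_add he, lastMult, lastMult, lastMult, lastMult, fn_mul_scaleFam0, fn_mul_scaleFam0, fn_mul_scaleFam0, fn_mul_scaleFam0,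
      fn_mul_scaleFam0, fn_mul_scaleFam0]
    linear_combination (ρ.lift.fn e) * hB
  unfold W
  rw [Psum_le_one (le_refl 1), smul_zero, add_zero, eY, eX, eY0, eX0, sY, sYt, sX, sXt, sY0, sX0]
  exact kite_abs_one (algebraMap ℚ R ab) (algebraMap ℚ R bb) t tX tY _ _ _ _ _ _ _ hkey

/-- **THE KITE**: `𝒲_j ≡ 0` in every positive degree. [folklore] -/
theorem kite (H : K.Hyp R ab bb t tX tY) :
    ∀ (j k : ℕ) (ρ : RFun (m + k)) (π : MvPolynomial (Fin (m + k)) ℚ) (hπ : IsScale π), K.W (χ := χ) ab bb t tX tY (j + 1) ρ π hπ = 0 := by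
  intro j
  induction j with
  | zero => exact K.kite_one hrel H
  | succ p ih => exact K.kite_succ hrel H (Nat.succ_pos p) ih

end KiteData

end KiteStep


/-! ## The KITE at the base stage: joints factor, and the product identity -/

section KiteProduct

open Shuffle NCSeries

variable {R : Type} [CommRing R] [Algebra ℚ R] {χ : KZ.FormalRep →+ R} (hrel : ∀ c ∈ KZ.relations, χ c = 0)
variable (hmul : ∀ x y : KZ.FormalRep, χ (x * y) = χ x * χ y)
variable {ι : Type} [Fintype ι] [DecidableEq ι]
variable {A : Type} [Ring A] [Algebra R A] [Module ℚ A] [IsScalarTower ℚ R A]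

/-- The full scale `1` over no riders is a rider scale. [folklore] -/
theorem isScale_one0 : IsScale (m := 0) (k := 0) (1 : MvPolynomial (Fin (0 + 0)) ℚ) := fun _ _ => by
  rw [map_one]; exact ⟨zero_le_one, le_rfl⟩

/-- The block swap reading a joint over no riders as a tensor product. [folklore] -/
def prodEquiv (n₁ n₂ : ℕ) : Fin ((n₂ + 0) + (n₁ + 0)) ≃ Fin (n₁ + (0 + n₂)) :=
  (finSumFinEquiv.symm.trans ((Equiv.sumComm (Fin (n₂ + 0)) (Fin (n₁ + 0))).trans finSumFinEquiv)).trans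
    (finCongr (by omega))

omit [Fintype ι] [DecidableEq ι] in
/-- The block swap on the passive block. [folklore] -/
theorem prodEquiv_left (n₁ n₂ : ℕ) (j : Fin (n₂ + 0)) :
    prodEquiv n₁ n₂ (Fin.castAdd (n₁ + 0) j) = Fin.natAdd n₁ (Fin.natAdd 0 j) := by
  apply Fin.ext; simp [prodEquiv]

omit [Fintype ι] [DecidableEq ι] in
/-- The block swap on the active block. [folklore] -/
theorem prodEquiv_right (n₁ n₂ : ℕ) (j : Fin (n₁ + 0)) :
    prodEquiv n₁ n₂ (Fin.natAdd (n₂ + 0) j) = Fin.castAdd (0 + n₂) j := by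
  apply Fin.ext; simp [prodEquiv]

include hrel hmul

omit [Algebra ℚ R] [Fintype ι] [DecidableEq ι] in
/-- **Joint coefficients factor over no riders**: `⟪(absorb μ Z₂_v) · Z₁_u⟫ = ⟪Z₂_v⟫ ⟪Z₁_u⟫` for a
multiplier `μ ≐ 1`. [folklore] -/
theorem zcoef_absorbR_one (D₁ D₂ : DirData ι 0) (μ : RFun 0) (hμ : ∀ e, μ.fn e = 1) (u v : List (Option ι)) :
    zcoef (χ := χ) (m := 0) (k := v.length) D₁.c D₁.hc D₁.d D₁.hd (absorbR μ (Zw D₂.c D₂.hc D₂.d D₂.hd v) 1 isScale_one0)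
        (liftPi v.length 1) (isScale_liftPi isScale_one0) u =
      zcoef (χ := χ) (m := 0) (k := 0) D₂.c D₂.hc D₂.d D₂.hd (RFun.const 1) 1 isScale_one0 v *
        zcoef (χ := χ) (m := 0) (k := 0) D₁.c D₁.hc D₁.d D₁.hd (RFun.const 1) 1 isScale_one0 u := by
  rw [zcoef, zcoef, zcoef, ← RFun.chi_tensor hrel hmul,
    ← RFun.chi_rename hrel ((famTerm (m := 0) (k := 0) (RFun.const 1) (Zw D₂.c D₂.hc D₂.d D₂.hd v) 1 isScale_one0).tensor
      (famTerm (m := 0) (k := 0) (RFun.const 1) (Zw D₁.c D₁.hc D₁.d D₁.hd u) 1 isScale_one0)) (prodEquiv u.length v.length)]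
  refine RFun.chi_congr hrel fun y _ => ?_
  rw [fn_famTerm, fn_absorbR, hμ, one_mul, RFun.fn_rename, RFun.fn_tensor, fn_famTerm, fn_famTerm, RFun.fn_const, RFun.fn_const]
  push_cast
  rw [one_mul, one_mul]
  refine congrArg₂ (· * ·) (congrArg (Zw D₂.c D₂.hc D₂.d D₂.hd v).fn (layout_ext (N := v.length) (Mr := 0) ?_ ?_ ?_))
    (congrArg (Zw D₁.c D₁.hc D₁.d D₁.hd u).fn (layout_ext (N := u.length) (Mr := 0) ?_ ?_ ?_))
  · funext j
    rw [wX_famPt, wX_absPt]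
    exact (congrArg y (prodEquiv_left u.length v.length j)).symm
  · funext j; exact Fin.elim0 j
  · rw [wScale_famPt, wScale_absPt, map_one, map_one]
  · funext j
    rw [wX_famPt, wX_famPt]
    exact (congrArg y (prodEquiv_right u.length v.length j)).symm
  · funext j; exact Fin.elim0 j
  · rw [wScale_famPt, wScale_famPt, liftPi, map_one, map_one, map_one]

/-- **Joints factor at the base stage**: `JZ_{i,i'}[μ](1) = ZS₁_i · ZS₂_{i'}` for `μ ≐ 1`, both
degrees positive. [folklore] -/
theorem JZ_base_eq_mul (D₁ D₂ : DirData ι 0) {i i' : ℕ} (_hi : 0 < i) (hi' : 0 < i') (t₁ t₂ : Option ι → A)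
    (μ : RFun 0) (hμ : ∀ e, μ.fn e = 1) :
    JZ (χ := χ) (M := 0) D₁ D₂ i i' t₁ t₂ 1 μ 1 isScale_one0 =
      ZS (χ := χ) (m := 0) (k := 0) D₁.c D₁.hc D₁.d D₁.hd i t₁ none (RFun.const 1) 1 isScale_one0 *
        ZS (χ := χ) (m := 0) (k := 0) D₂.c D₂.hc D₂.d D₂.hd i' t₂ none (RFun.const 1) 1 isScale_one0 := by
  have hne : ∀ g : Fin i' → Option ι, List.ofFn g ≠ [] := by
    intro g h; have := congrArg List.length h; simp at this; omega
  -- the slot-1 series with an absorbed multiplier is a scalar multiple of the base one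
  have hZ : ∀ v : List (Option ι),
      ZS (χ := χ) (m := 0) (k := v.length) D₁.c D₁.hc D₁.d D₁.hd i t₁ none
        (absorbR μ (Zw D₂.c D₂.hc D₂.d D₂.hd v) 1 isScale_one0) (liftPi v.length 1) (isScale_liftPi isScale_one0) =
      zcoef (χ := χ) (m := 0) (k := 0) D₂.c D₂.hc D₂.d D₂.hd (RFun.const 1) 1 isScale_one0 v •
        ZS (χ := χ) (m := 0) (k := 0) D₁.c D₁.hc D₁.d D₁.hd i t₁ none (RFun.const 1) 1 isScale_one0 := by
    intro v
    unfold ZS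
    rw [← evalW_smul']
    congr 1; funext W
    simp only [Zser, NCSeries.smul_apply]
    split_ifs
    · simp
    · simp only [pair, Finsupp.sum, smul_eq_mul, Finset.mul_sum, mul_smul_comm]
      exact Finset.sum_congr rfl fun u _ => by rw [zcoef_absorbR_one hrel hmul D₁ D₂ μ hμ u v]
  unfold JZ Jsum
  conv_rhs => arg 2; rw [ZS, evalW]
  rw [Finset.mul_sum]
  refine Finset.sum_congr rfl fun g _ => ?_
  simp only [mul_one, hZ, Zser, if_neg (hne g), smul_mul_assoc, mul_smul_comm, tprod]
  exact pair_smul_const _ _ _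

omit hrel hmul [Fintype ι] [DecidableEq ι] [Algebra R A] [Module ℚ A] [IsScalarTower ℚ R A] in
/-- **The degree sum of the joint sums is a product**: `Σ_{j<2N} Σ_{i+i'=j+1} F_i G_{i'} = (Σ_{a<N} F_{a+1})(Σ_{b<N} G_{b+1})`
for `F, G` vanishing above `N`. [folklore] -/
theorem sum_Psum_mul (N : ℕ) (F G : ℕ → A) (hF : ∀ j, N < j → F j = 0) (hG : ∀ j, N < j → G j = 0) :
    ∑ j ∈ Finset.range (2 * N), Psum (j + 1) (fun i i' => F i * G i') =
      (∑ a ∈ Finset.range N, F (a + 1)) * (∑ b ∈ Finset.range N, G (b + 1)) := by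
  unfold Psum
  simp only
  rw [Finset.sum_sigma', Finset.sum_mul_sum, ← Finset.sum_product']
  rw [← Finset.sum_filter_of_ne (p := fun x : (Σ _ : ℕ, ℕ) => x.2 ≤ N ∧ x.1 + 1 - x.2 ≤ N) (fun x _ hne => by
    by_contra hP
    rcases not_and_or.1 hP with h | h
    · exact hne (by rw [hF x.2 (not_le.1 h), zero_mul])
    · exact hne (by rw [hG (x.1 + 1 - x.2) (not_le.1 h), mul_zero]))]
  refine Finset.sum_bij' (fun x _ => (x.2 - 1, x.1 - x.2)) (fun y _ => ⟨y.1 + y.2 + 1, y.1 + 1⟩) ?_ ?_ ?_ ?_ ?_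
  · intro x hx
    simp only [Finset.mem_filter, Finset.mem_sigma, Finset.mem_range, Finset.mem_Ico] at hx
    simp only [Finset.mem_product, Finset.mem_range]
    omega
  · intro y hy
    simp only [Finset.mem_product, Finset.mem_range] at hy
    simp only [Finset.mem_filter, Finset.mem_sigma, Finset.mem_range, Finset.mem_Ico]
    omega
  · intro x hx
    simp only [Finset.mem_filter, Finset.mem_sigma, Finset.mem_range, Finset.mem_Ico] at hx
    obtain ⟨⟨h1, h2, h3⟩, h4, h5⟩ := hx
    exact Sigma.ext (by simp only; omega) (heq_of_eq (by simp only; omega))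
  · intro y hy
    simp only [Finset.mem_product, Finset.mem_range] at hy
    ext <;> simp only <;> omega
  · intro x hx
    simp only [Finset.mem_filter, Finset.mem_sigma, Finset.mem_range, Finset.mem_Ico] at hx
    obtain ⟨⟨h1, h2, h3⟩, h4, h5⟩ := hx
    simp only
    congr 2 <;> omega

omit hrel hmul [Algebra ℚ R] [Fintype ι] [DecidableEq ι] [Module ℚ A] [IsScalarTower ℚ R A] in
/-- **Summing the degreewise KITE gives the product identity** for series vanishing above `N`:
`(1 + bb ΣQ^y)(1 + ab ΣQ^{0x}) = (1 + ab ΣQ^x)(1 + bb ΣQ^{0y})`. [folklore] -/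
theorem product_identity {N : ℕ} (Qy Q0x Qx Q0y : ℕ → A) (ab' bb' : R)
    (hkite : ∀ j, bb' • Qy (j + 1) + ab' • Q0x (j + 1) - ab' • Qx (j + 1) - bb' • Q0y (j + 1) +
      (ab' * bb') • Psum (j + 1) (fun i i' => Qy i * Q0x i' - Qx i * Q0y i') = 0)
    (hy : ∀ j, N < j → Qy j = 0) (h0x : ∀ j, N < j → Q0x j = 0) (hx : ∀ j, N < j → Qx j = 0) (h0y : ∀ j, N < j → Q0y j = 0) :
    (1 + ∑ j ∈ Finset.range N, bb' • Qy (j + 1)) * (1 + ∑ j ∈ Finset.range N, ab' • Q0x (j + 1)) =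
      (1 + ∑ j ∈ Finset.range N, ab' • Qx (j + 1)) * (1 + ∑ j ∈ Finset.range N, bb' • Q0y (j + 1)) := by
  have hsum := Finset.sum_eq_zero (s := Finset.range (2 * N)) fun j _ => hkite j
  have hsingle : ∀ (F : ℕ → A), (∀ j, N < j → F j = 0) →
      ∑ j ∈ Finset.range (2 * N), F (j + 1) = ∑ j ∈ Finset.range N, F (j + 1) := by
    intro F hF
    rw [show 2 * N = N + N by ring, Finset.sum_range_add,
      Finset.sum_eq_zero (s := Finset.range N) (f := fun x => F (N + x + 1)) fun x _ => hF _ (by omega), add_zero]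
  have hj : ∀ j, Psum (j + 1) (fun i i' => Qy i * Q0x i' - Qx i * Q0y i') =
      Psum (j + 1) (fun i i' => Qy i * Q0x i') - Psum (j + 1) (fun i i' => Qx i * Q0y i') := fun j => Psum_sub _ _ _
  simp only [hj, Finset.sum_add_distrib, Finset.sum_sub_distrib, ← Finset.smul_sum, hsingle _ hy, hsingle _ h0x, hsingle _ hx,
    hsingle _ h0y, sum_Psum_mul N _ _ hy h0x, sum_Psum_mul N _ _ hx h0y] at hsum
  simp only [← Finset.smul_sum]
  rw [← sub_eq_zero, ← hsum]
  simp only [mul_add, add_mul, one_mul, mul_one, smul_mul_assoc, mul_smul_comm]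
  module

namespace KiteData

variable (K : KiteData ι 0) {ab bb : ℚ} {t : ι → A} {tX tY : A}

/-- The base-stage single series of a direction of the kite, degree `j`. [folklore] -/
def Q (D : DirData ι (0 + 1)) (tr : Option ι → A) (j : ℕ) : A :=
  ZS (χ := χ) (m := 0) (k := 0) (D.substY (k := 0) 1 isScale_one0).c (D.substY (k := 0) 1 isScale_one0).hc
    (D.substY (k := 0) 1 isScale_one0).d (D.substY (k := 0) 1 isScale_one0).hd j tr none (RFun.const 1) 1 isScale_one0

/-- **The KITE at the base stage, degree by degree**:
`bb Q^y_j + ab Q^{0x}_j − ab Q^x_j − bb Q^{0y}_j + ab·bb Σ_{i+i'=j} (Q^y_i Q^{0x}_{i'} − Q^x_i Q^{0y}_{i'}) = 0`. [folklore] -/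
theorem kite_base (H : K.Hyp R ab bb t tX tY) (j : ℕ) :
    algebraMap ℚ R bb • Q (χ := χ) K.Dy (resid t tY) (j + 1) + algebraMap ℚ R ab • Q (χ := χ) K.D0x (resid t tX) (j + 1) -
      algebraMap ℚ R ab • Q (χ := χ) K.Dx (resid t tX) (j + 1) - algebraMap ℚ R bb • Q (χ := χ) K.D0y (resid t tY) (j + 1) +
    (algebraMap ℚ R ab * algebraMap ℚ R bb) • Psum (j + 1) (fun i i' =>
      Q (χ := χ) K.Dy (resid t tY) i * Q (χ := χ) K.D0x (resid t tX) i' - Q (χ := χ) K.Dx (resid t tX) i * Q (χ := χ) K.D0y (resid t tY) i') = 0 := by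
  have h := K.kite hrel H j 0 (RFun.const 1) 1 isScale_one0
  unfold W at h
  have hμ : ∀ e, ((RFun.const 1 : RFun (0 + 0)).mul (RFun.poly (1 : MvPolynomial (Fin (0 + 0)) ℚ))).fn e = 1 := by
    intro e; rw [RFun.fn_mul, RFun.fn_const, RFun.fn_poly, map_one]; push_cast; ring
  rw [Psum_congr (fun i i' hi hi' _ => by
    rw [JZ_base_eq_mul hrel hmul _ _ hi hi' _ _ _ hμ, JZ_base_eq_mul hrel hmul _ _ hi hi' _ _ _ hμ])] at h
  exact h

/-- **THE CORNER PRODUCT IDENTITY** in an algebra where the four series vanish above degree `N`: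
`(1 + bb ΣQ^y)(1 + ab ΣQ^{0x}) = (1 + ab ΣQ^x)(1 + bb ΣQ^{0y})`. [folklore] -/
theorem corner_product (H : K.Hyp R ab bb t tX tY) {N : ℕ}
    (hy : ∀ j, N < j → Q (χ := χ) K.Dy (resid t tY) j = (0 : A)) (h0x : ∀ j, N < j → Q (χ := χ) K.D0x (resid t tX) j = (0 : A))
    (hx : ∀ j, N < j → Q (χ := χ) K.Dx (resid t tX) j = (0 : A)) (h0y : ∀ j, N < j → Q (χ := χ) K.D0y (resid t tY) j = (0 : A)) :
    (1 + ∑ j ∈ Finset.range N, algebraMap ℚ R bb • Q (χ := χ) K.Dy (resid t tY) (j + 1)) *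
        (1 + ∑ j ∈ Finset.range N, algebraMap ℚ R ab • Q (χ := χ) K.D0x (resid t tX) (j + 1)) =
      (1 + ∑ j ∈ Finset.range N, algebraMap ℚ R ab • Q (χ := χ) K.Dx (resid t tX) (j + 1)) *
        (1 + ∑ j ∈ Finset.range N, algebraMap ℚ R bb • Q (χ := χ) K.D0y (resid t tY) (j + 1)) :=
  product_identity _ _ _ _ _ _ (K.kite_base hrel hmul H) hy h0x hx h0y

end KiteData

end KiteProduct

end Literature.NumberTheory.Transcendental.KZ.Cube
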